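import Summits.QuantumFields.YangMills.Theorems.BalabanUVNodesN06GDSupSubLegAtPinsPUWI
import Literature.MathematicalPhysics.QuantumFieldTheory.Balaban1983to89.B9LettersZCFieldsAtPinsB
import Summits.QuantumFields.YangMills.Theorems.BalabanUVNodesN06D2SupLegAtPinsPUW
import Summits.QuantumFields.YangMills.Theorems.BalabanUVNodesN06SectDUnitsAtPinsPhys
import Literature.MathematicalPhysics.QuantumFieldTheory.Balaban1983to89.B9Thm312WholeFormSmallFromL2

/-!
# N06 [B9] — (3.137) BEFORE THE CERTIFICATE'S L² STEP, v2: the `hD2sup` letter from the Δ⁽²⁾-free G₀ core, the T_π half of the L² step and ROW 26 FOR `(QG̃Q*)⁻¹` ALONE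
# (programme P-D2, cut B″ + cut 1 of dag-n06-d's ⚑ LOCATED-D2-CYCLE ∕ -CYCLE-2: the C-letter `hc2` of v1 `…N06D2SupPrechainAtPinsPUW` is DERIVED here, Δ⁽²⁾-free)

T. Bałaban, *Propagators for lattice gauge theories in a background field*, Commun. Math. Phys. **99** (1985) 389–434 [`Balaban1985BackgroundPropagators`, "B9"], Thm 3.12
pp. 421–423 in print's order: G (3.130) [(Δ_a − Δ′_π)G = 1 from Thm 3.11's form bound for Δ′_π alone, (3.122)] → H (3.133) → Δ⁽²⁾ (3.134)–(3.137) → G₁ (3.138); (3.42) p. 397,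
(3.46) p. 398, (3.36) p. 396, p. 421; [5] = T. Bałaban, *Averaging operations for lattice gauge theories*, Commun. Math. Phys. **98** (1985) 17–51 [`Balaban1985Averaging`],
(149) p. 40; [4] = T. Bałaban, *Propagators and renormalization transformations for lattice gauge theories. II*, Commun. Math. Phys. **96** (1984) 223–250
[`Balaban1984PropagatorsII`], (2.51)–(2.56), Lemma 2.1 (2.60)–(2.61) pp. 232–234.

WHY (cell `pub-ymgap`, node N06, bundle F7 rows 20–21, seat dag-n06-l g33).  dag-n06-d's LOCATED-D2-CYCLE (2026-08-30): in the certificate the (3.137) letter `hD2sup` is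
consumed by the block-L² step, whose output feeds the G₀ bundle `…GUSP` (FormSmall ∕ Identities), whose outputs feed the U8 state layer — so a derivation of `hD2sup` may
use NEITHER the L² step NOR the `Identities` record.  THIS FILE does exactly that, in print's order: (i) the T_π HALF of the L² step (`htpi`, n06-w8's
`blockBd_tpi_of_letter_schemasR`, Δ⁽²⁾-free) with the G₀ data of the Δ⁽²⁾-free core `…GUSPC.g0_core_of_thm310_coreDir₃USP` (`hsym12`, `hpos12`, `hinvG0`, the L² block
`hl0`) gives Thm 3.11's relative form bound for Δ′_π ALONE (this lineage's `abs_form_le_of_stepBlockBd` + `weightedL2_le_form_of_l0`), hence — at the flat model of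
Δ⁽²⁾_π, which is the ZERO operator — the unit `Δ_a − Δ′_π` (`isUnit_deltaPiAY_of_formSmall_phys`) and def-Y's `(Δ_a − Δ′_π)·G = 1` at the pins
(`S0coK_sub_TpicoK_mul_GcoK_GDY`); (ii) PASS 1 v4 `…GDSupSubLegAtPinsPUWI.gdsup_sub_of_pins_inv` (the state layer at the flat residual + the regular-state resolvent entries of `G̃` and `G̃ − G₀`)
gives the scaled sup letter of `G_D`; (iii) `…D2SupLegAtPinsPUW.d2sup_of_pins` (n06-w8's transpose road, scaled, at `G′_phys`, [5] (149) at print's weight) gives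
(3.137) — and, NEW IN v2 (LOCATED-D2-CYCLE-2: in the certificate the C-letter is read off ROW 26, itself downstream of the TRUE state layer), the (3.132) class letter of
`C = (QG̃Q*)⁻¹` is DERIVED inside, Δ⁽²⁾-free, along print's own road «from (3.130) alone»: PASS 1 v4 `…N06GDSupSubLegAtPinsPUWI.gdsup_sub_of_pins_inv` (the two (2.51)
entries of `G̃` and `G̃ − G₀`) ⟹ ROW 26's transfers `B9Eq3132FacesAtLettersR.hdec26_of_majorants_of_R` (decay of `QG̃Q*`), `B9Eq3132CoerciveFromEnergyR.hcoA_of_refinesY_R` +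
`B9Eq3132CoerciveFromGAR.coerciveUnder_of_subMajorants_R` (coercivity, from ROW 17's `hΔA`) ⟹ `B9Eq3132NuReadingR.stmt3132Printed_nu_of_coercive_decay_R` (print's (3.132)
kernel bound for `(QG̃Q*)⁻¹`) ⟹ n06-w5's `B9LettersZCFieldsAtPinsB.c2_pinsB` (the class letter).  ★★★ `d2sup_prechain_v2_of_pins`: binders = v1's minus `hc2 Bz δC hBz hδC`, plus
`T₀ hT₀ hG0co12 hY a311 M311 ha311 hM311 hΔA hnbr` (ROW 26's Δ⁽²⁾-free inputs, all at certificate level before the L² step); output UNCHANGED: `∃ MD aD θ₂, 0 < aD ≤ a₀ ∧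
0 ≤ θ₂ ∧` the certificate's `hD2sup` family VERBATIM (at `Δ2 x`).
HONEST LABEL: helper (composition of landed faces by name), count-neutral; every analytic member a displayed HYPOTHESIS of printed species ([5] (149) included); N06
NOT discharged; nothing continuum ∕ OS ∕ mass gap ∕ Clay.  NEW file; nothing landed is modified.
-/

noncomputable section

namespace Summit.QuantumFields.YangMills.BalabanUVNodes.N06D2SupPrechainV2AtPinsPUW

open Literature.MathematicalPhysics.QuantumFieldTheory.Balaban1983to89 open Literature.MathematicalPhysics.QuantumFieldTheory.Balaban1983to89.Node00 (FBondY IBondY SiteY CfgY SiteParY SiteOpY parSymY GpY GpPhysY BondOpY parBY BondParY) open Literature.MathematicalPhysics.QuantumFieldTheory.Balaban1983to89.Node00.OpsYSectDCoords (DvcoKH DvscoKH TpicoK T2coK cR39_trBasis_pos) open B9Thm39ReadingCoords (cR39 coordBound39 basisBound39)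
open B9Thm34Ext (toB6) open B11SectG (HasMaj BlockNorm) open B9Thm312Whole (cNorm GeoOK) open B9Thm312WholeClasses (cNormR rwt rwt_nonneg)
open B9CoReadingCoords (XBK blkBK coordOpK cdBₗ) open B9CoReadingCoordsS (XSK sIK blkSK GcoS) open B9CoReadingCoordsH (XHK) open B9CoReadingCoordsTranspose (TrIdx trBasis)
open B9PinMembersKLevelV1 (MemberY geo9Y) open B9BackgroundsKLevelV1R (RegFamY bg9YR MemOfFam) open B9GeoLemma21KLevelV1 (geo9Y_len_pos geo9Y_dist_triangle geo9Y_dist_comm) open B9GeoNormsKLevelV1 (geo9K geo9K_dist_nonneg)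
open B7Prop2SpecialUnitary (specialUnitaryUnits) open B9PerturbationMajorantAlgebra (Proj349Maj Thm31GpMaj hasMaj_weaken) open B9PerturbationMajorantsAtLetters (PcoK) open B9MultiscaleSmoothPartitionYNear (rNear)
open B9MultiscaleSmoothPartitionYLip (CLip CLip_nonneg) open B9SmoothHolderClassP (bHZKP bHZKPG bHZPG) open B9GradViaDivLettersTransported (taxiB taxiS) open B9PerturbationSplitAtLetters (TaLcoK TbLcoKH Ta2LcoK Tb2LcoKH)
open B9PerturbationL2Delta2 (D2coK) open B9SmoothHolderClassPProducers (CTel CTel_nonneg) open B9RowSum261DefiniteFaces (rowConst261 rowConst261_nonneg) open B9SectDSup (weightNorm)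
open B6RandomWalk (HasMajorant) open B6RandomWalkHom (HasMajorantHom) open B9Thm312WholeStepRegular (StepS LettersS3131) open B9CoReadingCoordsHolder (PK)
open B9CoReadingCoordsHolderAdm (holderProbesKA) open B9RWSums343Holder (HolderProbes) open B9PerturbationMajorantAlgebra (CurrentMaj) open B9PerturbationMajorantsAtLetters (BcoKH BdcoKH)
open B9Thm313WholeDir (Thm33G0DirR) open B9Thm313WholeDirInputBC (Letters313IML) open B9LettersHZAtOne (plateau_pos) open B9CoReadingCoordsInput (bHK) open B9CoReadingCoordsInputS (bHS)
open B9CoRealizesRelAtLetters (RelB) open B9Thm33G0ProbeZeroAtCutPins (pX0_of_pins) open B6GlobalChartV1 (blkV1) open B6Ineq2142KLevelV1 (β lvl) open B6Geom246MultiLevelTorus (geomT) open Summit.QuantumFields.YangMills.BalabanUVNodes.N06HolderPinsGradedAtRecord (links_le_one)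
open Summit.QuantumFields.YangMills.BalabanUVNodes.N06TbHLegAtPinsPhysPU (htbH_of_pinsP43_geo9Y) open Summit.QuantumFields.YangMills.BalabanUVNodes.N06LettersSAtPinsPU (hLettersS_of_pinsP44_geo9Y) open Summit.QuantumFields.YangMills.BalabanUVNodes.N06StateClassFactsAtPinsPU (hStateFacts_of_pinsP_geo9Y) open Summit.QuantumFields.YangMills.BalabanUVNodes.N06StateProducerG0AtPinsPU (hG0S2_of_pinsP_geo9Y)
open Summit.QuantumFields.YangMills.BalabanUVNodes.N06StateProducersAAtPinsPU (hProducersA_of_pinsP_geo9Y) open Summit.QuantumFields.YangMills.BalabanUVNodes.N06StateProducersBAtPinsPUW (hProducersBW_of_pinsP_geo9Y) open Summit.QuantumFields.YangMills.BalabanUVNodes.N06StatePairsAtPinsPU (hStatePairs_of_pinsP_geo9Y) open Summit.QuantumFields.YangMills.BalabanUVNodes.N06StateAssemblyAtPinsPUW (hStateAssemblyW_of_faces)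
open scoped Matrix.Norms.L2Operator
open Summit.QuantumFields.YangMills.BalabanUVNodes.N06GDSupSubLegAtPinsPUWI (gdsup_sub_of_pins_inv)
open Literature.MathematicalPhysics.QuantumFieldTheory.Balaban1983to89.Node00 (deltaAY parBY_mem QGQOfY)
open Literature.MathematicalPhysics.QuantumFieldTheory.Balaban1983to89.B9Eq3132FacesAtLettersR (hdec26_of_majorants_of_R)
open Literature.MathematicalPhysics.QuantumFieldTheory.Balaban1983to89.B9Eq3132CoerciveFromGAR (coerciveUnder_of_subMajorants_R)
open Literature.MathematicalPhysics.QuantumFieldTheory.Balaban1983to89.B9Eq3132CoerciveFromEnergyR (hcoA_of_refinesY_R)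
open Literature.MathematicalPhysics.QuantumFieldTheory.Balaban1983to89.B9Eq3132NuReadingR (stmt3132Printed_nu_of_coercive_decay_R)
open Literature.MathematicalPhysics.QuantumFieldTheory.Balaban1983to89.B9Eq3132StepDifference (GcoK_sub)
open Literature.MathematicalPhysics.QuantumFieldTheory.Balaban1983to89.B9LettersZCFieldsAtPinsB (c2_pinsB)
open Literature.MathematicalPhysics.QuantumFieldTheory.Balaban1983to89.B9Thm311ReadingCoords (PosDefTr)
open Literature.MathematicalPhysics.QuantumFieldTheory.Balaban1983to89.B9BackgroundsKLevelV1R (regY335 regY336)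
open Literature.MathematicalPhysics.QuantumFieldTheory.Balaban1983to89.B9RWSumsReadsNbr (nbr)
open Literature.MathematicalPhysics.QuantumFieldTheory.Balaban1983to89.B9Ineq349SiteFromConv342 (contractive_of_mem)
open Literature.MathematicalPhysics.QuantumFieldTheory.Balaban1983to89.B7Prop2SpecialUnitary (specialUnitaryUnits_le_unitaryUnits)
open B9Thm39ReadingCoords (cR39_nonneg)
open Summit.QuantumFields.YangMills.BalabanUVNodes.N06D2SupLegAtPinsPUW (d2sup_of_pins)
open Summit.QuantumFields.YangMills.BalabanUVNodes.N06SectDUnitsAtPinsPhys (isUnit_deltaPiAY_of_formSmall_phys)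
open Literature.MathematicalPhysics.QuantumFieldTheory.Balaban1983to89.Node00 (Stage3Params C2Y delta2OfY trDualMatY delta2PiY)
open Literature.MathematicalPhysics.QuantumFieldTheory.Balaban1983to89.Node00.OpsYSectDCoords (S0coK CcoK S0coK_sub_TpicoK_mul_GcoK_GDY)
open Literature.MathematicalPhysics.QuantumFieldTheory.Balaban1983to89.B9BackgroundsKLevelV1P (bg9YP)
open Literature.MathematicalPhysics.QuantumFieldTheory.Balaban1983to89.B9PinGeometryKLevelV1 (c35Y)
open Literature.MathematicalPhysics.QuantumFieldTheory.Balaban1983to89.B9Eq3132SectDLetters (GDY)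
open Literature.MathematicalPhysics.QuantumFieldTheory.Balaban1983to89.B9Thm312Whole (FormSmall PosDefEnd)
open Literature.MathematicalPhysics.QuantumFieldTheory.Balaban1983to89.B9SectDL2Decay (bl2)
open Literature.MathematicalPhysics.QuantumFieldTheory.Balaban1983to89.B9Thm312WholeFormSmallFromL2 (abs_form_le_of_stepBlockBd weightedL2_le_form_of_l0)
open Literature.MathematicalPhysics.QuantumFieldTheory.Balaban1983to89.B11SectG (RowSum)
open Literature.MathematicalPhysics.QuantumFieldTheory.Balaban1983to89.B9GeoLemma21KLevelV1 (rowSum261_geo9Y)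
open B9CoReadingCoords (GcoK)
open B9CoReadingCoordsH (blkHK)
open B9Delta2FormMajorant (C2FormMaj)

variable {N : ℕ} {θ : Stage3Params} {Mstar : ℕ}

set_option maxHeartbeats 3200000 in
/-- ★★★ **(3.137) BEFORE THE L² STEP, v2 — THE C-LETTER DERIVED** (module docstring): `∃ MD aD θ₂, 0 < aD ≤ a₀ ∧ 0 ≤ θ₂ ∧` the certificate's `hD2sup` family at `Δ2 x`, from the
state layer's Δ⁽²⁾-free inputs, the G₀ core's resolvent data, the T_π half of the L² step, ROW 17's energy estimate and [5] (149); (3.132) for `(QG̃Q*)⁻¹` derived inside.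
[cite: Balaban1985BackgroundPropagators, Thm 3.12 pp.421–423 + (3.130)–(3.132) pp.421–422 + Thm 3.11 p.416 + (3.42) p.397 + (3.46) p.398; Balaban1985Averaging, (149) p.40; Balaban1984PropagatorsII, (2.51)–(2.56) pp.232–233 + Lemma 2.1 (2.60)–(2.61) p.234] -/
theorem d2sup_prechain_v2_of_pins [NeZero N] [∀ x : MemberY θ.d₆ θ.ℓ₆ θ.hd' θ.hL' θ.b₀ θ.b₁ Mstar, Fintype (geo9Y x).Site] [∀ x : MemberY θ.d₆ θ.ℓ₆ θ.hd' θ.hL' θ.b₀ θ.b₁ Mstar, DecidableRel (RelB x.toKIdx)]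
    [∀ x : MemberY θ.d₆ θ.ℓ₆ θ.hd' θ.hL' θ.b₀ θ.b₁ Mstar, DecidableEq (geo9Y x).Site]
    {R₁ R₂ : RegFamY θ.d₆ θ.ℓ₆ θ.hd' θ.hL' θ.b₀ θ.b₁ Mstar (Matrix (Fin N) (Fin N) ℂ)} (H : MemberY θ.d₆ θ.ℓ₆ θ.hd' θ.hL' θ.b₀ θ.b₁ Mstar → Prop)
    (bI : ∀ x : MemberY θ.d₆ θ.ℓ₆ θ.hd' θ.hL' θ.b₀ θ.b₁ Mstar, FBondY x.toKIdx → IBondY x.toKIdx)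
    (hlev : ∀ (x : MemberY θ.d₆ θ.ℓ₆ θ.hd' θ.hL' θ.b₀ θ.b₁ Mstar) (f : FBondY x.toKIdx), lvl x.hN x.D x.hk (bI x f) = (blkV1 x.hN x.D f).1.1)
    (hβ1 : ∀ (x : MemberY θ.d₆ θ.ℓ₆ θ.hd' θ.hL' θ.b₀ θ.b₁ Mstar) (f : FBondY x.toKIdx), (geomT x.D).dist (β x.hN x.D x.hk (bI x f)) (blkV1 x.hN x.D f) ≤ 1)
    (hbI0 : ∀ (x : MemberY θ.d₆ θ.ℓ₆ θ.hd' θ.hL' θ.b₀ θ.b₁ Mstar) (f : FBondY x.toKIdx), bI x f = bI x ⟨f.src, 0⟩)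
    (hGR : MemOfFam (specialUnitaryUnits (Fin N)) R₁)
    (c : ℝ) {M₀ a₀ : ℝ} (hM₀ : 0 ≤ M₀) {σ τ : ℝ} (hσ : 0 < σ) (hτ : 0 < τ)
    (w13 : ℝ → ℝ) (hw13₀ : ∀ s, 0 ≤ w13 s) (hw13₁ : ∀ s, w13 s ≤ 1) (wX : ℝ → ℝ) (hwX₀ : ∀ s, 0 ≤ wX s) (hwX₁ : ∀ s, wX s ≤ 1)
    {s44 : ℝ} (hs440 : 0 < s44) (hs441 : s44 < 1) (hw1344 : 0 < w13 s44) (hwX44 : 0 < wX s44)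
    (bH13 : ∀ x : MemberY θ.d₆ θ.ℓ₆ θ.hd' θ.hL' θ.b₀ θ.b₁ Mstar, (bg9YR (Matrix (Fin N) (Fin N) ℂ) (specialUnitaryUnits (Fin N)) R₁ R₂ x).Cfg → BlockNorm (toB6 (geo9Y x) 1 (H x)) (XSK (TrIdx N) x.toKIdx → ℝ))
    (hbH13 : ∀ (x : MemberY θ.d₆ θ.ℓ₆ θ.hd' θ.hL' θ.b₀ θ.b₁ Mstar) (U : (bg9YR (Matrix (Fin N) (Fin N) ℂ) (specialUnitaryUnits (Fin N)) R₁ R₂ x).Cfg), bH13 x U =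
      letI : Fintype (geo9K x.toKIdx).Site := (inferInstance : Fintype (geo9Y x).Site);
      bHZPG (κ := TrIdx N) x.toKIdx (trBasis N) (taxiS x.toKIdx (bg9YR (Matrix (Fin N) (Fin N) ℂ) (specialUnitaryUnits (Fin N)) R₁ R₂ x) (fun U => U) U) (R := (1 : ℝ)) (H := H x) w13 hw13₀ hw13₁)
    (hκ13 : ∀ (x : MemberY θ.d₆ θ.ℓ₆ θ.hd' θ.hL' θ.b₀ θ.b₁ Mstar) (U : (bg9YR (Matrix (Fin N) (Fin N) ℂ) (specialUnitaryUnits (Fin N)) R₁ R₂ x).Cfg), (bH13 x U).κ ≤ 1 + CLip θ.d₆ θ.ℓ₆)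
    (bXH : ∀ x : MemberY θ.d₆ θ.ℓ₆ θ.hd' θ.hL' θ.b₀ θ.b₁ Mstar, (bg9YR (Matrix (Fin N) (Fin N) ℂ) (specialUnitaryUnits (Fin N)) R₁ R₂ x).Cfg → BlockNorm (toB6 (geo9Y x) 1 (H x)) (XBK (TrIdx N) x.toKIdx → ℝ))
    (hbXH : ∀ (x : MemberY θ.d₆ θ.ℓ₆ θ.hd' θ.hL' θ.b₀ θ.b₁ Mstar) (U : (bg9YR (Matrix (Fin N) (Fin N) ℂ) (specialUnitaryUnits (Fin N)) R₁ R₂ x).Cfg), bXH x U =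
      letI : Fintype (geo9K x.toKIdx).Site := (inferInstance : Fintype (geo9Y x).Site);
      bHZKPG (κ := TrIdx N) x.toKIdx (trBasis N) (taxiB x.toKIdx (bg9YR (Matrix (Fin N) (Fin N) ℂ) (specialUnitaryUnits (Fin N)) R₁ R₂ x) (fun U => U) U) (R := (1 : ℝ)) (H := H x) wX hwX₀ hwX₁)
    (bHXA : ∀ x : MemberY θ.d₆ θ.ℓ₆ θ.hd' θ.hL' θ.b₀ θ.b₁ Mstar, ℝ → BlockNorm (toB6 (geo9Y x) 1 (H x)) (XBK (TrIdx N) x.toKIdx → ℝ))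
    (hbHXA : ∀ x : MemberY θ.d₆ θ.ℓ₆ θ.hd' θ.hL' θ.b₀ θ.b₁ Mstar, bHXA x = fun ε => letI : Fintype (geo9K x.toKIdx).Site := (inferInstance : Fintype (geo9Y x).Site); bHK x.toKIdx (bI x) ε)
    (bW : ∀ x : MemberY θ.d₆ θ.ℓ₆ θ.hd' θ.hL' θ.b₀ θ.b₁ Mstar, (bg9YR (Matrix (Fin N) (Fin N) ℂ) (specialUnitaryUnits (Fin N)) R₁ R₂ x).Cfg → ℝ → BlockNorm (toB6 (geo9Y x) 1 (H x)) (XSK (TrIdx N) x.toKIdx → ℝ))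
    (𝔬12 : ∀ x : MemberY θ.d₆ θ.ℓ₆ θ.hd' θ.hL' θ.b₀ θ.b₁ Mstar, B9Thm312Whole.Ops (geo9Y x) (bg9YR (Matrix (Fin N) (Fin N) ℂ) (specialUnitaryUnits (Fin N)) R₁ R₂ x) (XBK (TrIdx N) x.toKIdx) (XBK (TrIdx N) x.toKIdx) (XHK (TrIdx N) x.toKIdx) (XSK (TrIdx N) x.toKIdx))
    (hblk12 : ∀ x : MemberY θ.d₆ θ.ℓ₆ θ.hd' θ.hL' θ.b₀ θ.b₁ Mstar, (𝔬12 x).blk = blkBK x.toKIdx (bI x))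
    (hblkW12 : ∀ x : MemberY θ.d₆ θ.ℓ₆ θ.hd' θ.hL' θ.b₀ θ.b₁ Mstar, (𝔬12 x).blkW = blkSK x.toKIdx (sIK x.toKIdx (bI x)))
    (𝔠 : C2Y N θ Mstar)
    (Δ2 : ∀ x : MemberY θ.d₆ θ.ℓ₆ θ.hd' θ.hL' θ.b₀ θ.b₁ Mstar, BondOpY (Matrix (Fin N) (Fin N) ℂ) x.toKIdx)
    (hΔ2def : ∀ x : MemberY θ.d₆ θ.ℓ₆ θ.hd' θ.hL' θ.b₀ θ.b₁ Mstar, Δ2 x = (delta2OfY (trDualMatY N) x.toKIdx (parSymY x.toKIdx) (parBY x.toKIdx) (GpPhysY x.toKIdx (parSymY x.toKIdx)) (𝔠 x).form))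
    (hTpico12 : ∀ (x : MemberY θ.d₆ θ.ℓ₆ θ.hd' θ.hL' θ.b₀ θ.b₁ Mstar) (U : (bg9YR (Matrix (Fin N) (Fin N) ℂ) (specialUnitaryUnits (Fin N)) R₁ R₂ x).Cfg), (𝔬12 x).Tpi U = TpicoK x.toKIdx (trBasis N) (bg9YR (Matrix (Fin N) (Fin N) ℂ) (specialUnitaryUnits (Fin N)) R₁ R₂ x) (fun U => U) (parSymY x.toKIdx) (GpPhysY x.toKIdx (parSymY x.toKIdx)) U)
    (hDvco12 : ∀ (x : MemberY θ.d₆ θ.ℓ₆ θ.hd' θ.hL' θ.b₀ θ.b₁ Mstar) (U : (bg9YR (Matrix (Fin N) (Fin N) ℂ) (specialUnitaryUnits (Fin N)) R₁ R₂ x).Cfg), (𝔬12 x).Dv U = DvcoKH x.toKIdx (trBasis N) (bg9YR (Matrix (Fin N) (Fin N) ℂ) (specialUnitaryUnits (Fin N)) R₁ R₂ x) (fun U => U) U)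
    (hDvsco12 : ∀ (x : MemberY θ.d₆ θ.ℓ₆ θ.hd' θ.hL' θ.b₀ θ.b₁ Mstar) (U : (bg9YR (Matrix (Fin N) (Fin N) ℂ) (specialUnitaryUnits (Fin N)) R₁ R₂ x).Cfg), (𝔬12 x).Dvstar U = DvscoKH x.toKIdx (trBasis N) (bg9YR (Matrix (Fin N) (Fin N) ℂ) (specialUnitaryUnits (Fin N)) R₁ R₂ x) (fun U => U) U)
    (𝔭A : ∀ x : MemberY θ.d₆ θ.ℓ₆ θ.hd' θ.hL' θ.b₀ θ.b₁ Mstar, HolderProbes (geo9Y x) (bg9YR (Matrix (Fin N) (Fin N) ℂ) (specialUnitaryUnits (Fin N)) R₁ R₂ x) (XBK (TrIdx N) x.toKIdx) (XBK (TrIdx N) x.toKIdx) (PK (FBondY x.toKIdx) (Fin (θ.d₆ + 1)) (TrIdx N)) (PK (FBondY x.toKIdx) (Fin (θ.d₆ + 1)) (TrIdx N)))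
    {parB : ∀ x : MemberY θ.d₆ θ.ℓ₆ θ.hd' θ.hL' θ.b₀ θ.b₁ Mstar, BondParY (Matrix (Fin N) (Fin N) ℂ) x.toKIdx}
    (hparB : ∀ x : MemberY θ.d₆ θ.ℓ₆ θ.hd' θ.hL' θ.b₀ θ.b₁ Mstar, parB x = parBY x.toKIdx)
    (h𝔭A : ∀ x : MemberY θ.d₆ θ.ℓ₆ θ.hd' θ.hL' θ.b₀ θ.b₁ Mstar, 𝔭A x = holderProbesKA x.toKIdx (trBasis N) (bg9YR (Matrix (Fin N) (Fin N) ℂ) (specialUnitaryUnits (Fin N)) R₁ R₂ x) (fun U => U) (parB x) (bI x))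
    (Dd Dsd : ∀ x : MemberY θ.d₆ θ.ℓ₆ θ.hd' θ.hL' θ.b₀ θ.b₁ Mstar, (bg9YR (Matrix (Fin N) (Fin N) ℂ) (specialUnitaryUnits (Fin N)) R₁ R₂ x).Cfg → Fin (θ.d₆ + 1) → Module.End ℝ (XBK (TrIdx N) x.toKIdx → ℝ))
    (hDd : ∀ (x : MemberY θ.d₆ θ.ℓ₆ θ.hd' θ.hL' θ.b₀ θ.b₁ Mstar) (U : (bg9YR (Matrix (Fin N) (Fin N) ℂ) (specialUnitaryUnits (Fin N)) R₁ R₂ x).Cfg), Dd x U = fun ν => coordOpK (trBasis N) (fun _ : Fin (θ.d₆ + 1) => cdBₗ x.toKIdx U ν))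
    {Gp : ∀ x : MemberY θ.d₆ θ.ℓ₆ θ.hd' θ.hL' θ.b₀ θ.b₁ Mstar, SiteOpY (Matrix (Fin N) (Fin N) ℂ) x.toKIdx}
    (hGp : ∀ x : MemberY θ.d₆ θ.ℓ₆ θ.hd' θ.hL' θ.b₀ θ.b₁ Mstar, Gp x = GpY x.toKIdx (parSymY x.toKIdx))
    {parS : ∀ x : MemberY θ.d₆ θ.ℓ₆ θ.hd' θ.hL' θ.b₀ θ.b₁ Mstar, SiteParY (Matrix (Fin N) (Fin N) ℂ) x.toKIdx}
    (hparS : ∀ x : MemberY θ.d₆ θ.ℓ₆ θ.hd' θ.hL' θ.b₀ θ.b₁ Mstar, parS x = parSymY x.toKIdx)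
    -- letters of the input facts (implicit, read off the facts) and the two target rates
    {B₀ δ₀ CP δ49 tJ δB B43 δ43 tA δT δ₂ B44 δ44 B12₃ δ12₃ Bx13₀ B12₀ δ12₀ B₀G δ₀G BHG B₃ δ₃ δK δP CW : ℝ} {Bx13 Bh12 Bi BhG Bd BhD BdX : ℝ → ℝ}
    (hB₀ : 0 ≤ B₀) (hCP : 0 ≤ CP) (htJ : 0 ≤ tJ) (hB43 : 0 ≤ B43) (htA : 0 ≤ tA) (hB44 : 0 ≤ B44) (hB12₃ : 0 ≤ B12₃) (hBx13 : ∀ β, 0 ≤ β → β < 1 → 0 ≤ Bx13 β) (hBx13₀ : 0 ≤ Bx13₀)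
    (hwBx13 : ∀ s, 0 < s → s < 1 → wX s * Bx13 s ≤ Bx13₀) (hB12₀ : 0 ≤ B12₀) (hBh12 : ∀ β, 0 ≤ β → β < 1 → 0 ≤ Bh12 β) (hBi : ∀ ε, 0 < ε → ε ≤ 1 → 0 ≤ Bi ε) (hB₀G : 0 ≤ B₀G) (hBhG : ∀ s, 0 < s → s < 1 → 0 ≤ BhG s)
    (hBHG : 0 ≤ BHG) (hwBhG : ∀ s, 0 < s → s < 1 → wX s * BhG s ≤ BHG) (hBd : ∀ ε, 0 < ε → 0 ≤ Bd ε) (hCW : 0 ≤ CW) (hB₃ : 0 ≤ B₃) (hBhD : ∀ β, 0 ≤ β → β < 1 → 0 ≤ BhD β) (hBdX : ∀ β, 0 ≤ β → β < 1 → 0 ≤ BdX β)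
    -- the rate budget: the step∕pair rate δK and the producer∕reading rate δP against the input rates (σ = the row-sum margin, τ = the (Lʲη)-weight loss)
    (hδK : 0 ≤ δK) (hr0 : δK + 3 * σ + 4 * τ ≤ δ₀) (hr49 : δK + 3 * σ + 4 * τ ≤ δ49) (hr2 : δK + 3 * σ + 4 * τ ≤ δ₂) (hr44 : δK + 3 * σ + 5 * τ ≤ δ44) (hrB : δK + 3 * σ + 4 * τ ≤ δB)
    (hr43 : δK + 2 * σ + τ ≤ δ43) (hrT : δK + τ + σ ≤ δT) (hK3d : δK + τ + σ ≤ δ₃) (hKP : δK + τ + σ ≤ δP)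
    (hP0 : δP + 2 * τ ≤ δ12₀) (hP3 : δP + σ + 2 * τ ≤ δ12₃) (hPG : δP + τ ≤ δ₀G)
    -- the input facts (all displayed hypotheses of the certificate of record or outputs of its G₀ layer), member-uniform above (M₀, a₀)
    (h31 : ∀ x : MemberY θ.d₆ θ.ℓ₆ θ.hd' θ.hL' θ.b₀ θ.b₁ Mstar, M₀ ≤ (geo9Y x).M → ∀ α₀ : ℝ, 0 < α₀ → (geo9Y x).M * α₀ ≤ a₀ → ∀ U : (bg9YR (Matrix (Fin N) (Fin N) ℂ) (specialUnitaryUnits (Fin N)) R₁ R₂ x).Cfg, (bg9YR (Matrix (Fin N) (Fin N) ℂ) (specialUnitaryUnits (Fin N)) R₁ R₂ x).Reg335 c α₀ U →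
      Thm31GpMaj (g := geo9Y x) (blkSK x.toKIdx (sIK x.toKIdx (bI x))) (blkBK x.toKIdx (bI x))
        (GcoS x.toKIdx (trBasis N) (bg9YR (Matrix (Fin N) (Fin N) ℂ) (specialUnitaryUnits (Fin N)) R₁ R₂ x) (fun U => U) (Gp x) U)
        (DvcoKH x.toKIdx (trBasis N) (bg9YR (Matrix (Fin N) (Fin N) ℂ) (specialUnitaryUnits (Fin N)) R₁ R₂ x) (fun U => U) U) (DvscoKH x.toKIdx (trBasis N) (bg9YR (Matrix (Fin N) (Fin N) ℂ) (specialUnitaryUnits (Fin N)) R₁ R₂ x) (fun U => U) U) 1 (H x) B₀ δ₀)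
    (h49 : ∀ x : MemberY θ.d₆ θ.ℓ₆ θ.hd' θ.hL' θ.b₀ θ.b₁ Mstar, M₀ ≤ (geo9Y x).M → ∀ α₀ : ℝ, 0 < α₀ → (geo9Y x).M * α₀ ≤ a₀ → ∀ U : (bg9YR (Matrix (Fin N) (Fin N) ℂ) (specialUnitaryUnits (Fin N)) R₁ R₂ x).Cfg, (bg9YR (Matrix (Fin N) (Fin N) ℂ) (specialUnitaryUnits (Fin N)) R₁ R₂ x).Reg335 c α₀ U →
      Proj349Maj (g := geo9Y x) (blkSK x.toKIdx (sIK x.toKIdx (bI x))) (blkBK x.toKIdx (bI x))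
        (PcoK x.toKIdx (trBasis N) (bg9YR (Matrix (Fin N) (Fin N) ℂ) (specialUnitaryUnits (Fin N)) R₁ R₂ x) (fun U => U) (parS x) (Gp x) U)
        (DvcoKH x.toKIdx (trBasis N) (bg9YR (Matrix (Fin N) (Fin N) ℂ) (specialUnitaryUnits (Fin N)) R₁ R₂ x) (fun U => U) U) (DvscoKH x.toKIdx (trBasis N) (bg9YR (Matrix (Fin N) (Fin N) ℂ) (specialUnitaryUnits (Fin N)) R₁ R₂ x) (fun U => U) U) 1 (H x) CP δ49)
    (h43 : ∀ x : MemberY θ.d₆ θ.ℓ₆ θ.hd' θ.hL' θ.b₀ θ.b₁ Mstar, letI : Fintype (geo9K x.toKIdx).Site := (inferInstance : Fintype (geo9Y x).Site); M₀ ≤ (geo9Y x).M → ∀ α₀ : ℝ, 0 < α₀ → (geo9Y x).M * α₀ ≤ a₀ → ∀ U : (bg9YR (Matrix (Fin N) (Fin N) ℂ) (specialUnitaryUnits (Fin N)) R₁ R₂ x).Cfg, (bg9YR (Matrix (Fin N) (Fin N) ℂ) (specialUnitaryUnits (Fin N)) R₁ R₂ x).Reg335 c α₀ U →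
      (bg9YR (Matrix (Fin N) (Fin N) ℂ) (specialUnitaryUnits (Fin N)) R₁ R₂ x).Reg336 c α₀ U →
        HasMaj (cNorm 1 (H x) (𝔬12 x).blk (fun y => (geo9Y_len_pos x y).le) 0) (bH13 x U)
          (GcoS x.toKIdx (trBasis N) (bg9YR (Matrix (Fin N) (Fin N) ℂ) (specialUnitaryUnits (Fin N)) R₁ R₂ x) (fun U => U) (GpY x.toKIdx (parSymY x.toKIdx)) U ∘ₗ DvscoKH x.toKIdx (trBasis N) (bg9YR (Matrix (Fin N) (Fin N) ℂ) (specialUnitaryUnits (Fin N)) R₁ R₂ x) (fun U => U) U)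
          (fun a a' => B43 * Real.exp (-(δ43 * (geo9Y x).dist a a'))))
    (h44G : ∀ x : MemberY θ.d₆ θ.ℓ₆ θ.hd' θ.hL' θ.b₀ θ.b₁ Mstar, letI : Fintype (geo9K x.toKIdx).Site := (inferInstance : Fintype (geo9Y x).Site); M₀ ≤ (geo9Y x).M → ∀ α₀ : ℝ, 0 < α₀ → (geo9Y x).M * α₀ ≤ a₀ → ∀ U : (bg9YR (Matrix (Fin N) (Fin N) ℂ) (specialUnitaryUnits (Fin N)) R₁ R₂ x).Cfg, (bg9YR (Matrix (Fin N) (Fin N) ℂ) (specialUnitaryUnits (Fin N)) R₁ R₂ x).Reg335 c α₀ U → (bg9YR (Matrix (Fin N) (Fin N) ℂ) (specialUnitaryUnits (Fin N)) R₁ R₂ x).Reg336 c α₀ U →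
      HasMaj (bHZKP (κ := TrIdx N) x.toKIdx (trBasis N) (taxiB x.toKIdx (bg9YR (Matrix (Fin N) (Fin N) ℂ) (specialUnitaryUnits (Fin N)) R₁ R₂ x) (fun U => U) U) (R := (1 : ℝ)) (H := H x) hs440.le hs441.le) (cNorm 1 (H x) (𝔬12 x).blk (fun y => (geo9Y_len_pos x y).le) 1)
        ((𝔬12 x).Dv U ∘ₗ GcoS x.toKIdx (trBasis N) (bg9YR (Matrix (Fin N) (Fin N) ℂ) (specialUnitaryUnits (Fin N)) R₁ R₂ x) (fun U => U) (GpY x.toKIdx (parSymY x.toKIdx)) U ∘ₗ (𝔬12 x).Dvstar U) (fun a b => B44 * Real.exp (-(δ44 * (geo9Y x).dist a b))))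
    (hta : ∀ x : MemberY θ.d₆ θ.ℓ₆ θ.hd' θ.hL' θ.b₀ θ.b₁ Mstar, M₀ ≤ (geo9Y x).M → ∀ α₀ : ℝ, 0 < α₀ → (geo9Y x).M * α₀ ≤ a₀ → ∀ U : (bg9YR (Matrix (Fin N) (Fin N) ℂ) (specialUnitaryUnits (Fin N)) R₁ R₂ x).Cfg, (bg9YR (Matrix (Fin N) (Fin N) ℂ) (specialUnitaryUnits (Fin N)) R₁ R₂ x).Reg335 c α₀ U →
      (bg9YR (Matrix (Fin N) (Fin N) ℂ) (specialUnitaryUnits (Fin N)) R₁ R₂ x).Reg336 c α₀ U → HasMaj (cNorm 1 (H x) (𝔬12 x).blk (fun y => (geo9Y_len_pos x y).le) 2) (cNorm 1 (H x) (𝔬12 x).blk (fun y => (geo9Y_len_pos x y).le) 0) (TaLcoK x.toKIdx (trBasis N) (bg9YR (Matrix (Fin N) (Fin N) ℂ) (specialUnitaryUnits (Fin N)) R₁ R₂ x) (fun U => U) (parSymY x.toKIdx) (GpPhysY x.toKIdx (parSymY x.toKIdx)) U) (fun a a' => tA * ((geo9Y x).M * α₀) * Real.exp (-(δT * (geo9Y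 x).dist a a'))))
    (hBJ : ∀ x : MemberY θ.d₆ θ.ℓ₆ θ.hd' θ.hL' θ.b₀ θ.b₁ Mstar, M₀ ≤ (geo9Y x).M → ∀ α₀ : ℝ, 0 < α₀ → (geo9Y x).M * α₀ ≤ a₀ → ∀ U : (bg9YR (Matrix (Fin N) (Fin N) ℂ) (specialUnitaryUnits (Fin N)) R₁ R₂ x).Cfg, (bg9YR (Matrix (Fin N) (Fin N) ℂ) (specialUnitaryUnits (Fin N)) R₁ R₂ x).Reg335 c α₀ U →
      (bg9YR (Matrix (Fin N) (Fin N) ℂ) (specialUnitaryUnits (Fin N)) R₁ R₂ x).Reg336 c α₀ U → CurrentMaj (𝔬12 x).blkW (𝔬12 x).blk (BcoKH x.toKIdx (trBasis N) (bg9YR (Matrix (Fin N) (Fin N) ℂ) (specialUnitaryUnits (Fin N)) R₁ R₂ x) (fun U => U) U)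
        (BdcoKH x.toKIdx (trBasis N) (bg9YR (Matrix (Fin N) (Fin N) ℂ) (specialUnitaryUnits (Fin N)) R₁ R₂ x) (fun U => U) U) 1 (H x) (tJ * ((geo9Y x).M * α₀)) δB)
    (hZ81 : ∀ x : MemberY θ.d₆ θ.ℓ₆ θ.hd' θ.hL' θ.b₀ θ.b₁ Mstar, M₀ ≤ (geo9Y x).M → ∀ α₀ : ℝ, 0 < α₀ → (geo9Y x).M * α₀ ≤ a₀ → ∀ U : (bg9YR (Matrix (Fin N) (Fin N) ℂ) (specialUnitaryUnits (Fin N)) R₁ R₂ x).Cfg, (bg9YR (Matrix (Fin N) (Fin N) ℂ) (specialUnitaryUnits (Fin N)) R₁ R₂ x).Reg335 c α₀ U → (bg9YR (Matrix (Fin N) (Fin N) ℂ) (specialUnitaryUnits (Fin N)) R₁ R₂ x).Reg336 c α₀ U →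
      HasMaj (cNorm 1 (H x) (𝔬12 x).blkW (fun y => (geo9Y_len_pos x y).le) 1) (cNorm 1 (H x) (𝔬12 x).blk (fun y => (geo9Y_len_pos x y).le) 2) ((𝔬12 x).G0 U ∘ₗ (𝔬12 x).Dv U)
        (fun a b => B12₃ * Real.exp (-(δ12₃ * (geo9Y x).dist a b))))
    (hpXDv : ∀ x : MemberY θ.d₆ θ.ℓ₆ θ.hd' θ.hL' θ.b₀ θ.b₁ Mstar, M₀ ≤ (geo9Y x).M → ∀ α₀ : ℝ, 0 < α₀ → (geo9Y x).M * α₀ ≤ a₀ → ∀ U : (bg9YR (Matrix (Fin N) (Fin N) ℂ) (specialUnitaryUnits (Fin N)) R₁ R₂ x).Cfg, (bg9YR (Matrix (Fin N) (Fin N) ℂ) (specialUnitaryUnits (Fin N)) R₁ R₂ x).Reg335 c α₀ U → (bg9YR (Matrix (Fin N) (Fin N) ℂ) (specialUnitaryUnits (Fin N)) R₁ R₂ x).Reg336 c α₀ U → ∀ β : ℝ, 0 ≤ β → β < 1 →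
      HasMaj (cNormR 1 (H x) (𝔬12 x).blkW (fun y => (geo9Y_len_pos x y).le) 0) (cNormR 1 (H x) (𝔭A x).blkPX (fun y => (geo9Y_len_pos x y).le) (β - 1))
        (((𝔭A x).ΦX U β ∘ₗ (𝔬12 x).G0 U) ∘ₗ (𝔬12 x).Dv U) (fun a b => Bx13 β * Real.exp (-(δ12₃ * (geo9Y x).dist a b))))
    (he0 : ∀ x : MemberY θ.d₆ θ.ℓ₆ θ.hd' θ.hL' θ.b₀ θ.b₁ Mstar, M₀ ≤ (geo9Y x).M → ∀ α₀ : ℝ, 0 < α₀ → (geo9Y x).M * α₀ ≤ a₀ → ∀ U : (bg9YR (Matrix (Fin N) (Fin N) ℂ) (specialUnitaryUnits (Fin N)) R₁ R₂ x).Cfg, (bg9YR (Matrix (Fin N) (Fin N) ℂ) (specialUnitaryUnits (Fin N)) R₁ R₂ x).Reg335 c α₀ U → (bg9YR (Matrix (Fin N) (Fin N) ℂ) (specialUnitaryUnits (Fin N)) R₁ R₂ x).Reg336 c α₀ U →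
      HasMajorant (g := toB6 (geo9Y x) 1 (H x)) (𝔬12 x).blk ((𝔬12 x).G0 U) (fun (a b : (geo9Y x).Site) => B12₀ * (geo9Y x).len a ^ 2 * Real.exp (-(δ12₀ * (geo9Y x).dist a b))))
    (he1d : ∀ x : MemberY θ.d₆ θ.ℓ₆ θ.hd' θ.hL' θ.b₀ θ.b₁ Mstar, M₀ ≤ (geo9Y x).M → ∀ α₀ : ℝ, 0 < α₀ → (geo9Y x).M * α₀ ≤ a₀ → ∀ U : (bg9YR (Matrix (Fin N) (Fin N) ℂ) (specialUnitaryUnits (Fin N)) R₁ R₂ x).Cfg, (bg9YR (Matrix (Fin N) (Fin N) ℂ) (specialUnitaryUnits (Fin N)) R₁ R₂ x).Reg335 c α₀ U → (bg9YR (Matrix (Fin N) (Fin N) ℂ) (specialUnitaryUnits (Fin N)) R₁ R₂ x).Reg336 c α₀ U → ∀ μ : Fin (θ.d₆ + 1),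
      HasMajorantHom (g := toB6 (geo9Y x) 1 (H x)) (𝔬12 x).blk (𝔬12 x).blk (Dd x U μ ∘ₗ (𝔬12 x).G0 U)
        (fun (a b : (geo9Y x).Site) => B12₀ * (geo9Y x).len a * Real.exp (-(δ12₀ * (geo9Y x).dist a b))))
    (he2 : ∀ x : MemberY θ.d₆ θ.ℓ₆ θ.hd' θ.hL' θ.b₀ θ.b₁ Mstar, M₀ ≤ (geo9Y x).M → ∀ α₀ : ℝ, 0 < α₀ → (geo9Y x).M * α₀ ≤ a₀ → ∀ U : (bg9YR (Matrix (Fin N) (Fin N) ℂ) (specialUnitaryUnits (Fin N)) R₁ R₂ x).Cfg, (bg9YR (Matrix (Fin N) (Fin N) ℂ) (specialUnitaryUnits (Fin N)) R₁ R₂ x).Reg335 c α₀ U → (bg9YR (Matrix (Fin N) (Fin N) ℂ) (specialUnitaryUnits (Fin N)) R₁ R₂ x).Reg336 c α₀ U →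
      HasMajorantHom (g := toB6 (geo9Y x) 1 (H x)) (𝔬12 x).blkY (𝔬12 x).blk ((𝔬12 x).G0 U ∘ₗ (𝔬12 x).Dstar U) (fun a b => B₀G * (geo9Y x).len a * Real.exp (-(δ₀G * (geo9Y x).dist a b))))
    (h43RG : ∀ x : MemberY θ.d₆ θ.ℓ₆ θ.hd' θ.hL' θ.b₀ θ.b₁ Mstar, M₀ ≤ (geo9Y x).M → ∀ α₀ : ℝ, 0 < α₀ → (geo9Y x).M * α₀ ≤ a₀ → ∀ U : (bg9YR (Matrix (Fin N) (Fin N) ℂ) (specialUnitaryUnits (Fin N)) R₁ R₂ x).Cfg, (bg9YR (Matrix (Fin N) (Fin N) ℂ) (specialUnitaryUnits (Fin N)) R₁ R₂ x).Reg335 c α₀ U → (bg9YR (Matrix (Fin N) (Fin N) ℂ) (specialUnitaryUnits (Fin N)) R₁ R₂ x).Reg336 c α₀ U →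
      ∀ s' : ℝ, 0 < s' → s' < 1 → HasMajorantHom (g := toB6 (geo9Y x) 1 (H x)) (𝔬12 x).blkY (𝔭A x).blkPX ((𝔭A x).ΦX U s' ∘ₗ ((𝔬12 x).G0 U ∘ₗ (𝔬12 x).Dstar U)) (fun (a b : (geo9Y x).Site) => BhG s' * (geo9Y x).len a ^ (1 - s') * Real.exp (-(δ₀G * (geo9Y x).dist a b))))
    (hgQs1 : ∀ x : MemberY θ.d₆ θ.ℓ₆ θ.hd' θ.hL' θ.b₀ θ.b₁ Mstar, M₀ ≤ (geo9Y x).M → ∀ α₀ : ℝ, 0 < α₀ → (geo9Y x).M * α₀ ≤ a₀ → ∀ U : (bg9YR (Matrix (Fin N) (Fin N) ℂ) (specialUnitaryUnits (Fin N)) R₁ R₂ x).Cfg, (bg9YR (Matrix (Fin N) (Fin N) ℂ) (specialUnitaryUnits (Fin N)) R₁ R₂ x).Reg335 c α₀ U → (bg9YR (Matrix (Fin N) (Fin N) ℂ) (specialUnitaryUnits (Fin N)) R₁ R₂ x).Reg336 c α₀ U →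
      HasMaj (weightNorm (BlockNorm.ofBlocks (toB6 (geo9Y x) 1 (H x)) (𝔬12 x).blkZ) (fun y => (geo9Y x).len y * (fun y => ((((θ.ℓ₆ + 1 : ℕ) : ℝ) ^ (θ.d₆ + 1)) ^ lvl x.hN x.D x.hk y)⁻¹) y) (fun y => (mul_pos (geo9Y_len_pos x y) (plateau_pos x.toKIdx y)).le)) (cNorm 1 (H x) (𝔬12 x).blk (fun y => (geo9Y_len_pos x y).le) 1) ((𝔬12 x).G0 U ∘ₗ (𝔬12 x).Qstar U) (fun a b => B12₃ * Real.exp (-(δ12₃ * (geo9Y x).dist a b))))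
    (hpXQs : ∀ x : MemberY θ.d₆ θ.ℓ₆ θ.hd' θ.hL' θ.b₀ θ.b₁ Mstar, M₀ ≤ (geo9Y x).M → ∀ α₀ : ℝ, 0 < α₀ → (geo9Y x).M * α₀ ≤ a₀ → ∀ U : (bg9YR (Matrix (Fin N) (Fin N) ℂ) (specialUnitaryUnits (Fin N)) R₁ R₂ x).Cfg, (bg9YR (Matrix (Fin N) (Fin N) ℂ) (specialUnitaryUnits (Fin N)) R₁ R₂ x).Reg335 c α₀ U → (bg9YR (Matrix (Fin N) (Fin N) ℂ) (specialUnitaryUnits (Fin N)) R₁ R₂ x).Reg336 c α₀ U → ∀ β : ℝ, 0 ≤ β → β < 1 →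
      HasMaj (weightNorm (BlockNorm.ofBlocks (toB6 (geo9Y x) 1 (H x)) (𝔬12 x).blkZ) (fun y => (geo9Y x).len y * (fun y => ((((θ.ℓ₆ + 1 : ℕ) : ℝ) ^ (θ.d₆ + 1)) ^ lvl x.hN x.D x.hk y)⁻¹) y) (fun y => (mul_pos (geo9Y_len_pos x y) (plateau_pos x.toKIdx y)).le)) (cNormR 1 (H x) (𝔭A x).blkPX (fun y => (geo9Y_len_pos x y).le) (β - 1)) (((𝔭A x).ΦX U β ∘ₗ (𝔬12 x).G0 U) ∘ₗ (𝔬12 x).Qstar U) (fun a b => Bx13 β * Real.exp (-(δ12₃ * (geo9Y x).dist a b))))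
    (hDirR : ∀ x : MemberY θ.d₆ θ.ℓ₆ θ.hd' θ.hL' θ.b₀ θ.b₁ Mstar, M₀ ≤ (geo9Y x).M → ∀ α₀ : ℝ, 0 < α₀ → (geo9Y x).M * α₀ ≤ a₀ → ∀ U : (bg9YR (Matrix (Fin N) (Fin N) ℂ) (specialUnitaryUnits (Fin N)) R₁ R₂ x).Cfg, (bg9YR (Matrix (Fin N) (Fin N) ℂ) (specialUnitaryUnits (Fin N)) R₁ R₂ x).Reg335 c α₀ U → (bg9YR (Matrix (Fin N) (Fin N) ℂ) (specialUnitaryUnits (Fin N)) R₁ R₂ x).Reg336 c α₀ U →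
      Thm33G0DirR (𝔬12 x) (Dsd x) 1 (H x) B12₀ δ12₀ U)
    (hDir : ∀ x : MemberY θ.d₆ θ.ℓ₆ θ.hd' θ.hL' θ.b₀ θ.b₁ Mstar, M₀ ≤ (geo9Y x).M → ∀ α₀ : ℝ, 0 < α₀ → (geo9Y x).M * α₀ ≤ a₀ → ∀ U : (bg9YR (Matrix (Fin N) (Fin N) ℂ) (specialUnitaryUnits (Fin N)) R₁ R₂ x).Cfg, (bg9YR (Matrix (Fin N) (Fin N) ℂ) (specialUnitaryUnits (Fin N)) R₁ R₂ x).Reg335 c α₀ U → (bg9YR (Matrix (Fin N) (Fin N) ℂ) (specialUnitaryUnits (Fin N)) R₁ R₂ x).Reg336 c α₀ U →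
      ∀ (q : Fin (θ.d₆ + 1) × Fin (θ.d₆ + 1)) (ε : ℝ), 0 < ε → ε ≤ 1 → HasMaj (bHXA x ε) (BlockNorm.ofBlocks (toB6 (geo9Y x) 1 (H x)) (𝔬12 x).blk) (Dd x U q.1 ∘ₗ ((𝔬12 x).G0 U ∘ₗ Dsd x U q.2))
        (fun (a b : (geo9Y x).Site) => Bi ε * Real.exp (-(δ12₀ * (geo9Y x).dist a b))))
    (hdgDvd : ∀ x : MemberY θ.d₆ θ.ℓ₆ θ.hd' θ.hL' θ.b₀ θ.b₁ Mstar, M₀ ≤ (geo9Y x).M → ∀ α₀ : ℝ, 0 < α₀ → (geo9Y x).M * α₀ ≤ a₀ → ∀ U : (bg9YR (Matrix (Fin N) (Fin N) ℂ) (specialUnitaryUnits (Fin N)) R₁ R₂ x).Cfg, (bg9YR (Matrix (Fin N) (Fin N) ℂ) (specialUnitaryUnits (Fin N)) R₁ R₂ x).Reg335 c α₀ U → (bg9YR (Matrix (Fin N) (Fin N) ℂ) (specialUnitaryUnits (Fin N)) R₁ R₂ x).Reg336 c α₀ U →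
      ∀ (ν : Fin (θ.d₆ + 1)) (ε : ℝ), 0 < ε →
        HasMaj (bW x U ε) (BlockNorm.ofBlocks (toB6 (geo9Y x) 1 (H x)) (𝔬12 x).blk) (Dd x U ν ∘ₗ ((𝔬12 x).G0 U ∘ₗ (𝔬12 x).Dv U)) (fun (a b : (geo9Y x).Site) => Bd ε * Real.exp (-(δ12₃ * (geo9Y x).dist a b))))
    -- (variant `W`) the site class DOMINATES the block-sup class of the site fields: the source transfer of the z-letters' sup word into `bW x U ε` (class lemma, displayed)
    (htransW : ∀ x : MemberY θ.d₆ θ.ℓ₆ θ.hd' θ.hL' θ.b₀ θ.b₁ Mstar, M₀ ≤ (geo9Y x).M → ∀ (U : (bg9YR (Matrix (Fin N) (Fin N) ℂ) (specialUnitaryUnits (Fin N)) R₁ R₂ x).Cfg) (ε : ℝ), 0 < ε → ∀ K : ℝ, 0 ≤ K → HasMaj (BlockNorm.ofBlocks (toB6 (geo9Y x) 1 (H x)) (blkSK x.toKIdx (sIK x.toKIdx (bI x)))) (cNormR 1 (H x) (blkBK x.toKIdx (bI x)) (fun y => (geo9Y_len_pos x y).le) (-1)) ((𝔬12 x).G0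 U ∘ₗ (𝔬12 x).Dv U) (fun a b => K * Real.exp (-((δ12₃ - τ) * (geo9Y x).dist a b))) →
      HasMaj (bW x U ε) (cNormR 1 (H x) (blkBK x.toKIdx (bI x)) (fun y => (geo9Y_len_pos x y).le) (-1)) ((𝔬12 x).G0 U ∘ₗ (𝔬12 x).Dv U) (fun a b => CW * K * Real.exp (-((δ12₃ - τ) * (geo9Y x).dist a b))))
    (he1 : ∀ x : MemberY θ.d₆ θ.ℓ₆ θ.hd' θ.hL' θ.b₀ θ.b₁ Mstar, M₀ ≤ (geo9Y x).M → ∀ α₀ : ℝ, 0 < α₀ → (geo9Y x).M * α₀ ≤ a₀ → ∀ U : (bg9YR (Matrix (Fin N) (Fin N) ℂ) (specialUnitaryUnits (Fin N)) R₁ R₂ x).Cfg, (bg9YR (Matrix (Fin N) (Fin N) ℂ) (specialUnitaryUnits (Fin N)) R₁ R₂ x).Reg335 c α₀ U → (bg9YR (Matrix (Fin N) (Fin N) ℂ) (specialUnitaryUnits (Fin N)) R₁ R₂ x).Reg336 c α₀ U →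
      HasMajorantHom (g := toB6 (geo9Y x) 1 (H x)) (𝔬12 x).blk (𝔬12 x).blkY ((𝔬12 x).D U ∘ₗ (𝔬12 x).G0 U) (fun (a b : (geo9Y x).Site) => B12₀ * (geo9Y x).len a * Real.exp (-(δ12₀ * (geo9Y x).dist a b))))
    (h43L : ∀ x : MemberY θ.d₆ θ.ℓ₆ θ.hd' θ.hL' θ.b₀ θ.b₁ Mstar, M₀ ≤ (geo9Y x).M → ∀ α₀ : ℝ, 0 < α₀ → (geo9Y x).M * α₀ ≤ a₀ → ∀ U : (bg9YR (Matrix (Fin N) (Fin N) ℂ) (specialUnitaryUnits (Fin N)) R₁ R₂ x).Cfg, (bg9YR (Matrix (Fin N) (Fin N) ℂ) (specialUnitaryUnits (Fin N)) R₁ R₂ x).Reg335 c α₀ U → (bg9YR (Matrix (Fin N) (Fin N) ℂ) (specialUnitaryUnits (Fin N)) R₁ R₂ x).Reg336 c α₀ U → ∀ β : ℝ, 0 ≤ β → β < 1 →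
      HasMajorantHom (g := toB6 (geo9Y x) 1 (H x)) (𝔬12 x).blk (𝔭A x).blkPY ((𝔭A x).ΦY U β ∘ₗ ((𝔬12 x).D U ∘ₗ (𝔬12 x).G0 U)) (fun (a b : (geo9Y x).Site) => Bh12 β * (geo9Y x).len a ^ (1 - β) * Real.exp (-(δ12₀ * (geo9Y x).dist a b))))
    (h43d : ∀ x : MemberY θ.d₆ θ.ℓ₆ θ.hd' θ.hL' θ.b₀ θ.b₁ Mstar, M₀ ≤ (geo9Y x).M → ∀ α₀ : ℝ, 0 < α₀ → (geo9Y x).M * α₀ ≤ a₀ → ∀ U : (bg9YR (Matrix (Fin N) (Fin N) ℂ) (specialUnitaryUnits (Fin N)) R₁ R₂ x).Cfg, (bg9YR (Matrix (Fin N) (Fin N) ℂ) (specialUnitaryUnits (Fin N)) R₁ R₂ x).Reg335 c α₀ U → (bg9YR (Matrix (Fin N) (Fin N) ℂ) (specialUnitaryUnits (Fin N)) R₁ R₂ x).Reg336 c α₀ U → ∀ (ν : Fin (θ.d₆ + 1)) (β : ℝ), 0 ≤ β → β < 1 →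
      HasMajorantHom (g := toB6 (geo9Y x) 1 (H x)) (𝔬12 x).blk (𝔭A x).blkPX ((𝔭A x).ΦX U β ∘ₗ (Dd x U ν ∘ₗ (𝔬12 x).G0 U)) (fun (a b : (geo9Y x).Site) => Bh12 β * (geo9Y x).len a ^ (1 - β) * Real.exp (-(δ12₀ * (geo9Y x).dist a b))))
    (hdgDH : ∀ x : MemberY θ.d₆ θ.ℓ₆ θ.hd' θ.hL' θ.b₀ θ.b₁ Mstar, M₀ ≤ (geo9Y x).M → ∀ α₀ : ℝ, 0 < α₀ → (geo9Y x).M * α₀ ≤ a₀ → ∀ U : (bg9YR (Matrix (Fin N) (Fin N) ℂ) (specialUnitaryUnits (Fin N)) R₁ R₂ x).Cfg, (bg9YR (Matrix (Fin N) (Fin N) ℂ) (specialUnitaryUnits (Fin N)) R₁ R₂ x).Reg335 c α₀ U → (bg9YR (Matrix (Fin N) (Fin N) ℂ) (specialUnitaryUnits (Fin N)) R₁ R₂ x).Reg336 c α₀ U →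
      HasMaj (bH13 x U) (cNorm 1 (H x) (𝔬12 x).blkY (fun y => (geo9Y_len_pos x y).le) 1) ((𝔬12 x).D U ∘ₗ (𝔬12 x).G0 U ∘ₗ (𝔬12 x).Dv U) (fun a a' => B₃ * Real.exp (-(δ₃ * (geo9Y x).dist a a'))))
    (hdgDHd : ∀ x : MemberY θ.d₆ θ.ℓ₆ θ.hd' θ.hL' θ.b₀ θ.b₁ Mstar, M₀ ≤ (geo9Y x).M → ∀ α₀ : ℝ, 0 < α₀ → (geo9Y x).M * α₀ ≤ a₀ → ∀ U : (bg9YR (Matrix (Fin N) (Fin N) ℂ) (specialUnitaryUnits (Fin N)) R₁ R₂ x).Cfg, (bg9YR (Matrix (Fin N) (Fin N) ℂ) (specialUnitaryUnits (Fin N)) R₁ R₂ x).Reg335 c α₀ U → (bg9YR (Matrix (Fin N) (Fin N) ℂ) (specialUnitaryUnits (Fin N)) R₁ R₂ x).Reg336 c α₀ U → ∀ ν : Fin (θ.d₆ + 1),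
      HasMaj (bH13 x U) (cNorm 1 (H x) (𝔬12 x).blk (fun y => (geo9Y_len_pos x y).le) 1) (Dd x U ν ∘ₗ (𝔬12 x).G0 U ∘ₗ (𝔬12 x).Dv U) (fun a a' => B₃ * Real.exp (-(δ₃ * (geo9Y x).dist a a'))))
    (hYd : ∀ x : MemberY θ.d₆ θ.ℓ₆ θ.hd' θ.hL' θ.b₀ θ.b₁ Mstar, M₀ ≤ (geo9Y x).M → ∀ α₀ : ℝ, 0 < α₀ → (geo9Y x).M * α₀ ≤ a₀ → ∀ U : (bg9YR (Matrix (Fin N) (Fin N) ℂ) (specialUnitaryUnits (Fin N)) R₁ R₂ x).Cfg, (bg9YR (Matrix (Fin N) (Fin N) ℂ) (specialUnitaryUnits (Fin N)) R₁ R₂ x).Reg335 c α₀ U → (bg9YR (Matrix (Fin N) (Fin N) ℂ) (specialUnitaryUnits (Fin N)) R₁ R₂ x).Reg336 c α₀ U → ∀ β : ℝ, 0 ≤ β → β < 1 →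
      HasMaj (bH13 x U) (cNormR 1 (H x) (𝔭A x).blkPY (fun y => (geo9Y_len_pos x y).le) (β - 1)) (((𝔭A x).ΦY U β ∘ₗ (𝔬12 x).D U ∘ₗ (𝔬12 x).G0 U) ∘ₗ (𝔬12 x).Dv U) (fun a a' => BhD β * Real.exp (-(δ₃ * (geo9Y x).dist a a'))))
    (hXd : ∀ x : MemberY θ.d₆ θ.ℓ₆ θ.hd' θ.hL' θ.b₀ θ.b₁ Mstar, M₀ ≤ (geo9Y x).M → ∀ α₀ : ℝ, 0 < α₀ → (geo9Y x).M * α₀ ≤ a₀ → ∀ U : (bg9YR (Matrix (Fin N) (Fin N) ℂ) (specialUnitaryUnits (Fin N)) R₁ R₂ x).Cfg, (bg9YR (Matrix (Fin N) (Fin N) ℂ) (specialUnitaryUnits (Fin N)) R₁ R₂ x).Reg335 c α₀ U → (bg9YR (Matrix (Fin N) (Fin N) ℂ) (specialUnitaryUnits (Fin N)) R₁ R₂ x).Reg336 c α₀ U → ∀ (ν : Fin (θ.d₆ + 1)) (β : ℝ), 0 ≤ β → β < 1 →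
      HasMaj (bH13 x U) (cNormR 1 (H x) (𝔭A x).blkPX (fun y => (geo9Y_len_pos x y).le) (β - 1)) (((𝔭A x).ΦX U β ∘ₗ Dd x U ν ∘ₗ (𝔬12 x).G0 U) ∘ₗ (𝔬12 x).Dv U) (fun a a' => BdX β * Real.exp (-(δ₃ * (geo9Y x).dist a a'))))
    -- NEW (P-D2, cut B″): positivity of the regime letter; the Δ⁽²⁾-free resolvent data of the model — `G₀Δ_a = 1`, Δ_a > 0 in coordinates, G₀ symmetric, its L² block
    -- (the `l0` field of `Thm33G0L2M`), the T_π HALF of the certificate's L² step (n06-w8 `blockBd_tpi_of_letter_schemasR`) with its row-sum margin; the rate of G_D's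
    -- sup letter; the pins of S₀ ∕ G ∕ C ∕ Z; the class bridge; the (3.132) class letter of C; [5] (149) at print's weight
    (ha₀ : 0 < a₀)
    (hinvG0 : ∀ x : MemberY θ.d₆ θ.ℓ₆ θ.hd' θ.hL' θ.b₀ θ.b₁ Mstar, M₀ ≤ (geo9Y x).M → ∀ α₀ : ℝ, 0 < α₀ → (geo9Y x).M * α₀ ≤ a₀ → ∀ U : (bg9YR (Matrix (Fin N) (Fin N) ℂ) (specialUnitaryUnits (Fin N)) R₁ R₂ x).Cfg, (bg9YR (Matrix (Fin N) (Fin N) ℂ) (specialUnitaryUnits (Fin N)) R₁ R₂ x).Reg335 c α₀ U →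
      (bg9YR (Matrix (Fin N) (Fin N) ℂ) (specialUnitaryUnits (Fin N)) R₁ R₂ x).Reg336 c α₀ U → (𝔬12 x).G0 U * (𝔬12 x).S0 U = 1)
    (hpos12 : ∀ x : MemberY θ.d₆ θ.ℓ₆ θ.hd' θ.hL' θ.b₀ θ.b₁ Mstar, M₀ ≤ (geo9Y x).M → ∀ α₀ : ℝ, 0 < α₀ → (geo9Y x).M * α₀ ≤ a₀ → ∀ U : (bg9YR (Matrix (Fin N) (Fin N) ℂ) (specialUnitaryUnits (Fin N)) R₁ R₂ x).Cfg, (bg9YR (Matrix (Fin N) (Fin N) ℂ) (specialUnitaryUnits (Fin N)) R₁ R₂ x).Reg335 c α₀ U →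
      (bg9YR (Matrix (Fin N) (Fin N) ℂ) (specialUnitaryUnits (Fin N)) R₁ R₂ x).Reg336 c α₀ U → B9Thm312Whole.PosDefEnd ((𝔬12 x).S0 U))
    (hsym12 : ∀ x : MemberY θ.d₆ θ.ℓ₆ θ.hd' θ.hL' θ.b₀ θ.b₁ Mstar, M₀ ≤ (geo9Y x).M → ∀ α₀ : ℝ, 0 < α₀ → (geo9Y x).M * α₀ ≤ a₀ → ∀ U : (bg9YR (Matrix (Fin N) (Fin N) ℂ) (specialUnitaryUnits (Fin N)) R₁ R₂ x).Cfg, (bg9YR (Matrix (Fin N) (Fin N) ℂ) (specialUnitaryUnits (Fin N)) R₁ R₂ x).Reg335 c α₀ U →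
      (bg9YR (Matrix (Fin N) (Fin N) ℂ) (specialUnitaryUnits (Fin N)) R₁ R₂ x).Reg336 c α₀ U → B9Thm37Glue.IsTransposePair ((𝔬12 x).G0 U) ((𝔬12 x).G0 U))
    {BL0 δL0 t2L δT σF : ℝ} (hBL0 : 0 ≤ BL0) (ht2L : 0 ≤ t2L) (hσF : 0 < σF) (hσF0 : σF ≤ δL0) (hσFT : σF ≤ δT)
    (hl0 : ∀ x : MemberY θ.d₆ θ.ℓ₆ θ.hd' θ.hL' θ.b₀ θ.b₁ Mstar, M₀ ≤ (geo9Y x).M → ∀ α₀ : ℝ, 0 < α₀ → (geo9Y x).M * α₀ ≤ a₀ → ∀ U : (bg9YR (Matrix (Fin N) (Fin N) ℂ) (specialUnitaryUnits (Fin N)) R₁ R₂ x).Cfg, (bg9YR (Matrix (Fin N) (Fin N) ℂ) (specialUnitaryUnits (Fin N)) R₁ R₂ x).Reg335 c α₀ U →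
      (bg9YR (Matrix (Fin N) (Fin N) ℂ) (specialUnitaryUnits (Fin N)) R₁ R₂ x).Reg336 c α₀ U →
        B9SectDL2Decay.BlockBd (g := toB6 (geo9Y x) 1 (H x)) (𝔬12 x).blk (𝔬12 x).blk ((𝔬12 x).G0 U)
          (fun (y y' : (geo9Y x).Site) => BL0 * (geo9Y x).len y * (geo9Y x).len y' * Real.exp (-(δL0 * (geo9Y x).dist y y'))))
    (htpi : ∀ x : MemberY θ.d₆ θ.ℓ₆ θ.hd' θ.hL' θ.b₀ θ.b₁ Mstar, M₀ ≤ (geo9Y x).M → ∀ α₀ : ℝ, 0 < α₀ → (geo9Y x).M * α₀ ≤ a₀ → ∀ U : (bg9YR (Matrix (Fin N) (Fin N) ℂ) (specialUnitaryUnits (Fin N)) R₁ R₂ x).Cfg, (bg9YR (Matrix (Fin N) (Fin N) ℂ) (specialUnitaryUnits (Fin N)) R₁ R₂ x).Reg335 c α₀ U →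
      (bg9YR (Matrix (Fin N) (Fin N) ℂ) (specialUnitaryUnits (Fin N)) R₁ R₂ x).Reg336 c α₀ U →
        B9SectDL2Decay.BlockBd (g := toB6 (geo9Y x) 1 (H x)) (𝔬12 x).blk (𝔬12 x).blk ((𝔬12 x).Tpi U)
          (fun (y y' : (geo9Y x).Site) => t2L * ((geo9Y x).M * α₀) * ((geo9Y x).len y)⁻¹ * ((geo9Y x).len y')⁻¹ * Real.exp (-(δT * (geo9Y x).dist y y'))))
    {ρG : ℝ} (hρG : 0 < ρG) (hρGP : ρG + σ ≤ δP) (hρGK : ρG + 2 * σ ≤ δK)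
    (hS0co12 : ∀ (x : MemberY θ.d₆ θ.ℓ₆ θ.hd' θ.hL' θ.b₀ θ.b₁ Mstar) (U : (bg9YR (Matrix (Fin N) (Fin N) ℂ) (specialUnitaryUnits (Fin N)) R₁ R₂ x).Cfg),
      (𝔬12 x).S0 U = S0coK x.toKIdx (trBasis N) (bg9YR (Matrix (Fin N) (Fin N) ℂ) (specialUnitaryUnits (Fin N)) R₁ R₂ x) (fun U => U) (parSymY x.toKIdx) (parBY x.toKIdx) (GpPhysY x.toKIdx (parSymY x.toKIdx)) U)
    (hblkZ12 : ∀ x : MemberY θ.d₆ θ.ℓ₆ θ.hd' θ.hL' θ.b₀ θ.b₁ Mstar, (𝔬12 x).blkZ = blkHK x.toKIdx)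
    (hGco12 : ∀ (x : MemberY θ.d₆ θ.ℓ₆ θ.hd' θ.hL' θ.b₀ θ.b₁ Mstar) (U : (bg9YR (Matrix (Fin N) (Fin N) ℂ) (specialUnitaryUnits (Fin N)) R₁ R₂ x).Cfg),
      (𝔬12 x).G U = GcoK x.toKIdx (trBasis N) (bg9YR (Matrix (Fin N) (Fin N) ℂ) (specialUnitaryUnits (Fin N)) R₁ R₂ x) (fun U => U) (GDY x.toKIdx (parSymY x.toKIdx) (parBY x.toKIdx) (GpPhysY x.toKIdx (parSymY x.toKIdx))) U)
    (hCco12 : ∀ (x : MemberY θ.d₆ θ.ℓ₆ θ.hd' θ.hL' θ.b₀ θ.b₁ Mstar) (U : (bg9YR (Matrix (Fin N) (Fin N) ℂ) (specialUnitaryUnits (Fin N)) R₁ R₂ x).Cfg),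
      (𝔬12 x).C U = CcoK x.toKIdx (trBasis N) (bg9YR (Matrix (Fin N) (Fin N) ℂ) (specialUnitaryUnits (Fin N)) R₁ R₂ x) (fun U => U) (parSymY x.toKIdx) (parBY x.toKIdx) (GpPhysY x.toKIdx (parSymY x.toKIdx)) U)
    (hRP2 : ∀ (x : MemberY θ.d₆ θ.ℓ₆ θ.hd' θ.hL' θ.b₀ θ.b₁ Mstar) (α₀ : ℝ) (U : (bg9YR (Matrix (Fin N) (Fin N) ℂ) (specialUnitaryUnits (Fin N)) R₁ R₂ x).Cfg), (bg9YR (Matrix (Fin N) (Fin N) ℂ) (specialUnitaryUnits (Fin N)) R₁ R₂ x).Reg336 c α₀ U →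
      0 ≤ α₀ ∧ (bg9YP (Matrix (Fin N) (Fin N) ℂ) (specialUnitaryUnits (Fin N)) x).Reg336 c35Y α₀ U)
    {κC δC2 : ℝ} (hκC : 0 ≤ κC) (hgap : δ₂ < δC2)
    -- NEW (cut 1 of LOCATED-D2-CYCLE-2): ROW 26's Δ⁽²⁾-free inputs for `(QG̃Q*)⁻¹` ALONE — the letter `T₀ = G_A = Δ_a⁻¹` with `G₀`'s pin, the class bridge `hY`, ROW 17's energy
    -- estimate `hΔA` (Thm 3.11), the neighbour count of the record geometry
    (T₀ : ∀ x : MemberY θ.d₆ θ.ℓ₆ θ.hd' θ.hL' θ.b₀ θ.b₁ Mstar, BondOpY (Matrix (Fin N) (Fin N) ℂ) x.toKIdx)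
    (hT₀ : ∀ (x : MemberY θ.d₆ θ.ℓ₆ θ.hd' θ.hL' θ.b₀ θ.b₁ Mstar) (U : CfgY (Matrix (Fin N) (Fin N) ℂ) x.toKIdx), T₀ x U = Ring.inverse (deltaAY x.toKIdx (parSymY x.toKIdx) (parBY x.toKIdx) (GpY x.toKIdx (parSymY x.toKIdx)) U))
    (hG0co12 : ∀ (x : MemberY θ.d₆ θ.ℓ₆ θ.hd' θ.hL' θ.b₀ θ.b₁ Mstar) (U : (bg9YR (Matrix (Fin N) (Fin N) ℂ) (specialUnitaryUnits (Fin N)) R₁ R₂ x).Cfg), (𝔬12 x).G0 U = GcoK x.toKIdx (trBasis N) (bg9YR (Matrix (Fin N) (Fin N) ℂ) (specialUnitaryUnits (Fin N)) R₁ R₂ x) (fun U => U) (T₀ x) U)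
    {c' : ℝ}
    (hY : ∀ (x : MemberY θ.d₆ θ.ℓ₆ θ.hd' θ.hL' θ.b₀ θ.b₁ Mstar) (α₀ : ℝ) (U : CfgY (Matrix (Fin N) (Fin N) ℂ) x.toKIdx), R₁ x c α₀ U → R₂ x c α₀ U →
      regY335 (Matrix (Fin N) (Fin N) ℂ) (specialUnitaryUnits (Fin N)) x c' α₀ U ∧ regY336 (Matrix (Fin N) (Fin N) ℂ) (specialUnitaryUnits (Fin N)) x c' α₀ U)
    (a311 M311 : ℝ) (ha311 : 0 < a311) (hM311 : 0 < M311)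
    (hΔA : ∀ x : MemberY θ.d₆ θ.ℓ₆ θ.hd' θ.hL' θ.b₀ θ.b₁ Mstar, M311 ≤ (geo9Y x).M → ∀ α₀ : ℝ, 0 < α₀ → (geo9Y x).M * α₀ ≤ a311 → ∀ U : (bg9YR (Matrix (Fin N) (Fin N) ℂ) (specialUnitaryUnits (Fin N)) R₁ R₂ x).Cfg, (bg9YR (Matrix (Fin N) (Fin N) ℂ) (specialUnitaryUnits (Fin N)) R₁ R₂ x).Reg335 c α₀ U →
      PosDefTr (fun _ => (1 : ℝ)) (deltaAY x.toKIdx (parSymY x.toKIdx) (parBY x.toKIdx) (GpY x.toKIdx (parSymY x.toKIdx)) U))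
    {mN : ℕ} (hnbr : ∀ (x : MemberY θ.d₆ θ.ℓ₆ θ.hd' θ.hL' θ.b₀ θ.b₁ Mstar) (y : (geo9Y x).Site), (nbr (geo9Y x) ((θ.ℓ₆ : ℝ) + 4) y).card ≤ mN)
    (hC2 : ∀ x : MemberY θ.d₆ θ.ℓ₆ θ.hd' θ.hL' θ.b₀ θ.b₁ Mstar, M₀ ≤ (geo9Y x).M → ∀ α₀ : ℝ, 0 < α₀ → (geo9Y x).M * α₀ ≤ a₀ → ∀ U : (bg9YR (Matrix (Fin N) (Fin N) ℂ) (specialUnitaryUnits (Fin N)) R₁ R₂ x).Cfg, (bg9YR (Matrix (Fin N) (Fin N) ℂ) (specialUnitaryUnits (Fin N)) R₁ R₂ x).Reg335 c α₀ U →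
      (bg9YR (Matrix (Fin N) (Fin N) ℂ) (specialUnitaryUnits (Fin N)) R₁ R₂ x).Reg336 c α₀ U →
        C2FormMaj x.toKIdx (g := geo9Y x) (bI x) (fun c => c) (𝔠 x).form U κC δC2 (fun c => (geo9Y x).len c * (((((θ.ℓ₆ + 1 : ℕ) : ℝ) ^ (θ.d₆ + 1)) ^ lvl x.hN x.D x.hk c)⁻¹))) :
    ∃ MD aD θ₂ : ℝ, 0 < aD ∧ aD ≤ a₀ ∧ 0 ≤ θ₂ ∧
      ∀ x : MemberY θ.d₆ θ.ℓ₆ θ.hd' θ.hL' θ.b₀ θ.b₁ Mstar, MD ≤ (geo9Y x).M → ∀ α₀ : ℝ, 0 < α₀ → (geo9Y x).M * α₀ ≤ aD → ∀ U : (bg9YR (Matrix (Fin N) (Fin N) ℂ) (specialUnitaryUnits (Fin N)) R₁ R₂ x).Cfg, (bg9YR (Matrix (Fin N) (Fin N) ℂ) (specialUnitaryUnits (Fin N)) R₁ R₂ x).Reg335 c α₀ U →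
      (bg9YR (Matrix (Fin N) (Fin N) ℂ) (specialUnitaryUnits (Fin N)) R₁ R₂ x).Reg336 c α₀ U →
        HasMajorant (g := toB6 (geo9Y x) 1 (H x)) (𝔬12 x).blk (D2coK x.toKIdx (trBasis N) (bg9YR (Matrix (Fin N) (Fin N) ℂ) (specialUnitaryUnits (Fin N)) R₁ R₂ x) (fun U => U) (Δ2 x) U)
          (fun (a b : (geo9Y x).Site) => θ₂ * ((geo9Y x).M * α₀) * ((geo9Y x).len a ^ 2)⁻¹ * Real.exp (-(δ₂ * (geo9Y x).dist a b))) := by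
  have hN : 0 < N := Nat.pos_of_ne_zero (NeZero.ne N)
  have hcR : cR39 (trBasis N) ≠ 0 := (cR39_trBasis_pos hN).ne'
  have hδ₂ : 0 ≤ δ₂ := by linarith
  -- [4] (2.61) at the form-bound row-sum rate σF
  obtain ⟨MLσ, cσ, hrow0⟩ := rowSum261_geo9Y (d := θ.d₆) (ℓ := θ.ℓ₆) (hd := θ.hd') (hL := θ.hL') (b₀ := θ.b₀) (b₁ := θ.b₁) (Mstar := Mstar) σF hσF
  set c' : ℝ := max cσ 0 with hc'
  have hc'0 : 0 ≤ c' := le_max_right _ _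
  have hrow : ∀ x : MemberY θ.d₆ θ.ℓ₆ θ.hd' θ.hL' θ.b₀ θ.b₁ Mstar, MLσ ≤ (geo9Y x).M → RowSum (toB6 (geo9Y x) 1 (H x)) σF c' := fun x hM y => (hrow0 x hM y).trans (le_max_left _ _)
  -- the T_π form ratio and the produced regime of its smallness (print's Thm 3.11 + (3.122): r·Mα₀ < 1)
  set r₁ : ℝ := t2L * c' * (BL0 * c') with hr₁
  have hr₁nn : 0 ≤ r₁ := mul_nonneg (mul_nonneg ht2L hc'0) (mul_nonneg hBL0 hc'0)
  set aP : ℝ := min a₀ (1 / (2 * r₁ + 2)) with haPdef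
  have haP0 : 0 < aP := lt_min ha₀ (by positivity)
  have haPa : aP ≤ a₀ := min_le_left _ _
  -- the flat model of Δ⁽²⁾_π vanishes
  have hT2z : ∀ (x : MemberY θ.d₆ θ.ℓ₆ θ.hd' θ.hL' θ.b₀ θ.b₁ Mstar) (U : (bg9YR (Matrix (Fin N) (Fin N) ℂ) (specialUnitaryUnits (Fin N)) R₁ R₂ x).Cfg), T2coK x.toKIdx (trBasis N) (bg9YR (Matrix (Fin N) (Fin N) ℂ) (specialUnitaryUnits (Fin N)) R₁ R₂ x) (fun U => U) (parSymY x.toKIdx) (GpPhysY x.toKIdx (parSymY x.toKIdx)) (0 : BondOpY (Matrix (Fin N) (Fin N) ℂ) x.toKIdx) U = 0 := by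
    intro x U
    refine LinearMap.ext fun f => funext fun p => ?_
    show (cR39 (trBasis N))⁻¹ * (trBasis N).repr ((((delta2PiY x.toKIdx (parSymY x.toKIdx) (GpPhysY x.toKIdx (parSymY x.toKIdx)) (0 : BondOpY (Matrix (Fin N) (Fin N) ℂ) x.toKIdx) ((fun U => U) U))).restrictScalars ℝ)
      (B9CoReadingCoords.assembleK (trBasis N) p.2.1 p.2.2.2 f) p.1) p.2.2.1 = 0
    simp [delta2PiY]
  -- the Δ⁽²⁾-free resolvent identity (Δ_a − Δ′_π)·G = 1 from the T_π form bound, above max M₀ MLσ, in the regime aP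
  have hinvG : ∀ x : MemberY θ.d₆ θ.ℓ₆ θ.hd' θ.hL' θ.b₀ θ.b₁ Mstar, max M₀ MLσ ≤ (geo9Y x).M → ∀ α₀ : ℝ, 0 < α₀ → (geo9Y x).M * α₀ ≤ aP → ∀ U : (bg9YR (Matrix (Fin N) (Fin N) ℂ) (specialUnitaryUnits (Fin N)) R₁ R₂ x).Cfg, (bg9YR (Matrix (Fin N) (Fin N) ℂ) (specialUnitaryUnits (Fin N)) R₁ R₂ x).Reg335 c α₀ U →
      (bg9YR (Matrix (Fin N) (Fin N) ℂ) (specialUnitaryUnits (Fin N)) R₁ R₂ x).Reg336 c α₀ U → ((𝔬12 x).S0 U - (𝔬12 x).Tpi U) * (𝔬12 x).G U = 1 := by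
    intro x hM α₀ hα ha U hU hU'
    have hM0 : M₀ ≤ (geo9Y x).M := (le_max_left _ _).trans hM
    have hMLσ : MLσ ≤ (geo9Y x).M := (le_max_right _ _).trans hM
    have ha0 : (geo9Y x).M * α₀ ≤ a₀ := ha.trans haPa
    have hgeo : GeoOK (geo9Y x) := ⟨geo9Y_dist_triangle x, geo9Y_dist_comm x, geo9K_dist_nonneg x.toKIdx, geo9Y_len_pos x⟩
    have hMα : 0 ≤ (geo9Y x).M * α₀ := mul_nonneg (hM₀.trans hM0) hα.le
    have hsmall : ∀ f : XBK (TrIdx N) x.toKIdx → ℝ, |f ⬝ᵥ (𝔬12 x).Tpi U f| ≤ r₁ * ((geo9Y x).M * α₀) * (f ⬝ᵥ (𝔬12 x).S0 U f) := by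
      intro f
      have h1 := abs_form_le_of_stepBlockBd (R₀ := 1) (H₀ := H x) hgeo (hrow x hMLσ) hσFT (mul_nonneg ht2L hMα) (htpi x hM0 α₀ hα ha0 U hU hU') f
      have h2 := weightedL2_le_form_of_l0 (R₀ := 1) (H₀ := H x) hgeo (hrow x hMLσ) hc'0 hσF0 hBL0 (hsym12 x hM0 α₀ hα ha0 U hU hU')
        (hpos12 x hM0 α₀ hα ha0 U hU hU') (hinvG0 x hM0 α₀ hα ha0 U hU hU') (hl0 x hM0 α₀ hα ha0 U hU hU') f
      calc |f ⬝ᵥ (𝔬12 x).Tpi U f| ≤ t2L * ((geo9Y x).M * α₀) * c' * ∑ y : (geo9Y x).Site, (((geo9Y x).len y)⁻¹ * bl2 (g := toB6 (geo9Y x) 1 (H x)) (𝔬12 x).blk y f) ^ 2 := h1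
        _ ≤ t2L * ((geo9Y x).M * α₀) * c' * (BL0 * c' * (f ⬝ᵥ (𝔬12 x).S0 U f)) :=
            mul_le_mul_of_nonneg_left h2 (mul_nonneg (mul_nonneg ht2L hMα) hc'0)
        _ = r₁ * ((geo9Y x).M * α₀) * (f ⬝ᵥ (𝔬12 x).S0 U f) := by rw [hr₁]; ring
    have hr1 : r₁ * ((geo9Y x).M * α₀) < 1 := by
      have ha3 : (geo9Y x).M * α₀ ≤ 1 / (2 * r₁ + 2) := ha.trans (min_le_right _ _)
      have h2 : 0 < 2 * r₁ + 2 := by positivity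
      calc r₁ * ((geo9Y x).M * α₀) ≤ r₁ * (1 / (2 * r₁ + 2)) := mul_le_mul_of_nonneg_left ha3 hr₁nn
        _ < 1 := by rw [mul_one_div, div_lt_one h2]; linarith
    -- the form smallness of the FLAT model (Δ⁽²⁾_π := 0) and the unit of Δ_a − Δ′_π at the pins
    have hF : FormSmall ({ 𝔬12 x with T2 := fun U => T2coK x.toKIdx (trBasis N) (bg9YR (Matrix (Fin N) (Fin N) ℂ) (specialUnitaryUnits (Fin N)) R₁ R₂ x) (fun U => U) (parSymY x.toKIdx) (GpPhysY x.toKIdx (parSymY x.toKIdx)) (0 : BondOpY (Matrix (Fin N) (Fin N) ℂ) x.toKIdx) U }) (r₁ * ((geo9Y x).M * α₀)) U := by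
      refine ⟨hpos12 x hM0 α₀ hα ha0 U hU hU', hsmall, fun f => ?_⟩
      show |f ⬝ᵥ ((𝔬12 x).Tpi U + T2coK x.toKIdx (trBasis N) (bg9YR (Matrix (Fin N) (Fin N) ℂ) (specialUnitaryUnits (Fin N)) R₁ R₂ x) (fun U => U) (parSymY x.toKIdx) (GpPhysY x.toKIdx (parSymY x.toKIdx)) (0 : BondOpY (Matrix (Fin N) (Fin N) ℂ) x.toKIdx) U) f| ≤ r₁ * ((geo9Y x).M * α₀) * (f ⬝ᵥ (𝔬12 x).S0 U f)
      rw [hT2z x U, add_zero]; exact hsmall f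
    have hUnit := isUnit_deltaPiAY_of_formSmall_phys x.toKIdx (bg9YR (Matrix (Fin N) (Fin N) ℂ) (specialUnitaryUnits (Fin N)) R₁ R₂ x) (fun U => U) _ U hN hF hr1 (hS0co12 x U) (hTpico12 x U)
    rw [hS0co12 x U, hTpico12 x U, hGco12 x U]
    exact S0coK_sub_TpicoK_mul_GcoK_GDY hcR hUnit
  -- PASS 1 v4: the two (2.51) entries of G_D and G_D − G₀ (`gdsup_sub_of_pins_inv`), regime (MG, aG), aG ≤ aP
  obtain ⟨MG, aG, rG, rG', haG0, haGP, hrG, hrG', hGD⟩ :=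
    gdsup_sub_of_pins_inv (N := N) (M₀ := max M₀ MLσ) (H := H) (bI := bI) (hlev := hlev) (hβ1 := hβ1) (hbI0 := hbI0) (hGR := hGR) (c := c) (hM₀ := le_max_of_le_left hM₀) (hσ := hσ) (hτ := hτ) (w13 := w13)
      (hw13₀ := hw13₀) (hw13₁ := hw13₁) (wX := wX) (hwX₀ := hwX₀) (hwX₁ := hwX₁) (hs440 := hs440) (hs441 := hs441) (hw1344 := hw1344) (hwX44 := hwX44) (bH13 := bH13) (hbH13 := hbH13)
      (hκ13 := hκ13) (bXH := bXH) (hbXH := hbXH) (bHXA := bHXA) (hbHXA := hbHXA) (bW := bW) (𝔬12 := 𝔬12) (hblk12 := hblk12) (hblkW12 := hblkW12) (hTpico12 := hTpico12) (hDvco12 := hDvco12)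
      (hDvsco12 := hDvsco12) (𝔭A := 𝔭A) (hparB := hparB) (h𝔭A := h𝔭A) (Dd := Dd) (Dsd := Dsd) (hDd := hDd) (hGp := hGp) (hparS := hparS) (hB₀ := hB₀) (hCP := hCP) (htJ := htJ) (hB43 := hB43)
      (htA := htA) (hB44 := hB44) (hB12₃ := hB12₃) (hBx13 := hBx13) (hBx13₀ := hBx13₀) (hwBx13 := hwBx13) (hB12₀ := hB12₀) (hBh12 := hBh12) (hBi := hBi) (hB₀G := hB₀G) (hBhG := hBhG)
      (hBHG := hBHG) (hwBhG := hwBhG) (hBd := hBd) (hCW := hCW) (hB₃ := hB₃) (hBhD := hBhD) (hBdX := hBdX) (hδK := hδK) (hr0 := hr0) (hr49 := hr49) (hr44 := hr44) (hrB := hrB) (hr43 := hr43)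
      (hrT := hrT) (hK3d := hK3d) (hKP := hKP) (hP0 := hP0) (hP3 := hP3) (hPG := hPG) (h31 := fun x hM α₀ hα ha => h31 x ((le_max_left _ _).trans hM) α₀ hα (ha.trans haPa))
      (h49 := fun x hM α₀ hα ha => h49 x ((le_max_left _ _).trans hM) α₀ hα (ha.trans haPa)) (h43 := fun x hM α₀ hα ha => h43 x ((le_max_left _ _).trans hM) α₀ hα (ha.trans haPa)) (h44G := fun x hM α₀ hα ha => h44G x ((le_max_left _ _).trans hM) α₀ hα (ha.trans haPa))
      (hta := fun x hM α₀ hα ha => hta x ((le_max_left _ _).trans hM) α₀ hα (ha.trans haPa)) (hBJ := fun x hM α₀ hα ha => hBJ x ((le_max_left _ _).trans hM) α₀ hα (ha.trans haPa)) (hZ81 := fun x hM α₀ hα ha => hZ81 x ((le_max_left _ _).trans hM) α₀ hα (ha.trans haPa))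
      (hpXDv := fun x hM α₀ hα ha => hpXDv x ((le_max_left _ _).trans hM) α₀ hα (ha.trans haPa)) (he0 := fun x hM α₀ hα ha => he0 x ((le_max_left _ _).trans hM) α₀ hα (ha.trans haPa))
      (he1d := fun x hM α₀ hα ha => he1d x ((le_max_left _ _).trans hM) α₀ hα (ha.trans haPa)) (he2 := fun x hM α₀ hα ha => he2 x ((le_max_left _ _).trans hM) α₀ hα (ha.trans haPa))
      (h43RG := fun x hM α₀ hα ha => h43RG x ((le_max_left _ _).trans hM) α₀ hα (ha.trans haPa)) (hgQs1 := fun x hM α₀ hα ha => hgQs1 x ((le_max_left _ _).trans hM) α₀ hα (ha.trans haPa))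
      (hpXQs := fun x hM α₀ hα ha => hpXQs x ((le_max_left _ _).trans hM) α₀ hα (ha.trans haPa)) (hDirR := fun x hM α₀ hα ha => hDirR x ((le_max_left _ _).trans hM) α₀ hα (ha.trans haPa))
      (hDir := fun x hM α₀ hα ha => hDir x ((le_max_left _ _).trans hM) α₀ hα (ha.trans haPa)) (hdgDvd := fun x hM α₀ hα ha => hdgDvd x ((le_max_left _ _).trans hM) α₀ hα (ha.trans haPa)) (htransW := fun x hM => htransW x ((le_max_left _ _).trans hM))
      (he1 := fun x hM α₀ hα ha => he1 x ((le_max_left _ _).trans hM) α₀ hα (ha.trans haPa)) (h43L := fun x hM α₀ hα ha => h43L x ((le_max_left _ _).trans hM) α₀ hα (ha.trans haPa))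
      (h43d := fun x hM α₀ hα ha => h43d x ((le_max_left _ _).trans hM) α₀ hα (ha.trans haPa)) (hdgDH := fun x hM α₀ hα ha => hdgDH x ((le_max_left _ _).trans hM) α₀ hα (ha.trans haPa))
      (hdgDHd := fun x hM α₀ hα ha => hdgDHd x ((le_max_left _ _).trans hM) α₀ hα (ha.trans haPa)) (hYd := fun x hM α₀ hα ha => hYd x ((le_max_left _ _).trans hM) α₀ hα (ha.trans haPa))
      (hXd := fun x hM α₀ hα ha => hXd x ((le_max_left _ _).trans hM) α₀ hα (ha.trans haPa)) (a₀ := aP) (ha₀ := haP0) (hinvG0 := fun x hM α₀ hα ha => hinvG0 x ((le_max_left _ _).trans hM) α₀ hα (ha.trans haPa))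
      (hinvG := hinvG) (hρG := hρG.le) (hρGP := hρGP) (hρGK := hρGK)
  have haGa : aG ≤ a₀ := haGP.trans haPa
  -- ROW 26 FOR `(QG̃Q*)⁻¹` ALONE (cut 1 of LOCATED-D2-CYCLE-2): the two (2.51) entries of PASS 1 ⟹ decay + coercivity of `QG̃Q*` ⟹ print's (3.132) kernel bound ⟹ the class letter of `C`
  have hMG1 : 0 < max MG 1 := lt_of_lt_of_le one_pos (le_max_right _ _)
  have hmajT : ∃ M₂ a₂ C δ : ℝ, 0 < M₂ ∧ 0 < a₂ ∧ 0 ≤ C ∧ 0 < δ ∧ ∀ x : MemberY θ.d₆ θ.ℓ₆ θ.hd' θ.hL' θ.b₀ θ.b₁ Mstar, M₂ ≤ (geo9Y x).M → ∀ α₀ : ℝ, 0 < α₀ → (geo9Y x).M * α₀ ≤ a₂ → ∀ U : (bg9YR (Matrix (Fin N) (Fin N) ℂ) (specialUnitaryUnits (Fin N)) R₁ R₂ x).Cfg, (bg9YR (Matrix (Fin N) (Fin N) ℂ) (specialUnitaryUnits (Fin N)) R₁ R₂ x).Reg335 c α₀ U →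
      (bg9YR (Matrix (Fin N) (Fin N) ℂ) (specialUnitaryUnits (Fin N)) R₁ R₂ x).Reg336 c α₀ U →
        HasMajorant (g := toB6 (geo9Y x) ((fun _ : MemberY θ.d₆ θ.ℓ₆ θ.hd' θ.hL' θ.b₀ θ.b₁ Mstar => (1 : ℝ)) x) (H x)) (blkBK x.toKIdx (bI x)) (GcoK x.toKIdx (trBasis N) (bg9YR (Matrix (Fin N) (Fin N) ℂ) (specialUnitaryUnits (Fin N)) R₁ R₂ x) (fun U => U) ((fun x : MemberY θ.d₆ θ.ℓ₆ θ.hd' θ.hL' θ.b₀ θ.b₁ Mstar => GDY x.toKIdx (parSymY x.toKIdx) (parBY x.toKIdx) (GpPhysY x.toKIdx (parSymY x.toKIdx))) x) U)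
            (fun a a' => C * (geo9Y x).len a ^ 2 * Real.exp (-(δ * (geo9Y x).dist a a'))) ∧
          HasMajorant (g := toB6 (geo9Y x) ((fun _ : MemberY θ.d₆ θ.ℓ₆ θ.hd' θ.hL' θ.b₀ θ.b₁ Mstar => (1 : ℝ)) x) (H x)) (blkBK x.toKIdx (bI x)) (GcoK x.toKIdx (trBasis N) (bg9YR (Matrix (Fin N) (Fin N) ℂ) (specialUnitaryUnits (Fin N)) R₁ R₂ x) (fun U => U) ((fun x : MemberY θ.d₆ θ.ℓ₆ θ.hd' θ.hL' θ.b₀ θ.b₁ Mstar => GDY x.toKIdx (parSymY x.toKIdx) (parBY x.toKIdx) (GpPhysY x.toKIdx (parSymY x.toKIdx))) x) U)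
            (fun a a' => C * (geo9Y x).len a ^ 2 * Real.exp (-(δ * (geo9Y x).dist a a'))) :=
    ⟨max MG 1, aG, rG, ρG, hMG1, haG0, hrG, hρG, fun x hM α₀ hα ha U hU hU' => by
      have h := (hGD x ((le_max_left _ _).trans hM) α₀ hα ha U hU hU').1
      rw [hblk12 x, hGco12 x U] at h
      exact ⟨h, h⟩⟩
  have hsubT : ∃ M₂ a₂ C δ : ℝ, 0 < M₂ ∧ 0 < a₂ ∧ 0 ≤ C ∧ 0 < δ ∧ ∀ x : MemberY θ.d₆ θ.ℓ₆ θ.hd' θ.hL' θ.b₀ θ.b₁ Mstar, M₂ ≤ (geo9Y x).M → ∀ α₀ : ℝ, 0 < α₀ → (geo9Y x).M * α₀ ≤ a₂ → ∀ U : (bg9YR (Matrix (Fin N) (Fin N) ℂ) (specialUnitaryUnits (Fin N)) R₁ R₂ x).Cfg, (bg9YR (Matrix (Fin N) (Fin N) ℂ) (specialUnitaryUnits (Fin N)) R₁ R₂ x).Reg335 c α₀ U →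
      (bg9YR (Matrix (Fin N) (Fin N) ℂ) (specialUnitaryUnits (Fin N)) R₁ R₂ x).Reg336 c α₀ U →
        HasMajorant (g := toB6 (geo9Y x) ((fun _ : MemberY θ.d₆ θ.ℓ₆ θ.hd' θ.hL' θ.b₀ θ.b₁ Mstar => (1 : ℝ)) x) (H x)) (blkBK x.toKIdx (bI x)) (GcoK x.toKIdx (trBasis N) (bg9YR (Matrix (Fin N) (Fin N) ℂ) (specialUnitaryUnits (Fin N)) R₁ R₂ x) (fun U => U) ((fun x : MemberY θ.d₆ θ.ℓ₆ θ.hd' θ.hL' θ.b₀ θ.b₁ Mstar => GDY x.toKIdx (parSymY x.toKIdx) (parBY x.toKIdx) (GpPhysY x.toKIdx (parSymY x.toKIdx))) x - T₀ x) U)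
          (fun a a' => C * ((geo9Y x).M * α₀) * (geo9Y x).len a ^ 2 * Real.exp (-(δ * (geo9Y x).dist a a'))) :=
    ⟨max MG 1, aG, rG', ρG, hMG1, haG0, hrG', hρG, fun x hM α₀ hα ha U hU hU' => by
      have h := (hGD x ((le_max_left _ _).trans hM) α₀ hα ha U hU hU').2
      rw [hblk12 x, hGco12 x U, hG0co12 x U, ← GcoK_sub] at h
      exact h⟩
  have hdec := (hdec26_of_majorants_of_R θ Mstar R₁ R₂ hGR (trBasis N) (trBasis N) (fun x : MemberY θ.d₆ θ.ℓ₆ θ.hd' θ.hL' θ.b₀ θ.b₁ Mstar => GDY x.toKIdx (parSymY x.toKIdx) (parBY x.toKIdx) (GpPhysY x.toKIdx (parSymY x.toKIdx))) (fun x : MemberY θ.d₆ θ.ℓ₆ θ.hd' θ.hL' θ.b₀ θ.b₁ Mstar => GDY x.toKIdx (parSymY x.toKIdx) (parBY x.toKIdx) (GpPhysY x.toKIdx (parSymY x.toKIdx))) hlev hβ1 hnbr (R := fun _ => (1 : ℝ)) hmajT).1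
  have hparG : ∀ (x : MemberY θ.d₆ θ.ℓ₆ θ.hd' θ.hL' θ.b₀ θ.b₁ Mstar) (U : CfgY (Matrix (Fin N) (Fin N) ℂ) x.toKIdx), (∀ μ y, U μ y ∈ specialUnitaryUnits (Fin N)) →
      ∀ s s', ‖(parBY x.toKIdx U s s' : Matrix (Fin N) (Fin N) ℂ)‖ ≤ 1 ∧ ‖(((parBY x.toKIdx U s s')⁻¹ : (Matrix (Fin N) (Fin N) ℂ)ˣ) : Matrix (Fin N) (Fin N) ℂ)‖ ≤ 1 :=
    fun x U hUG s s' => contractive_of_mem specialUnitaryUnits_le_unitaryUnits (parBY_mem x.toKIdx hUG s s')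
  have hcoA := hcoA_of_refinesY_R θ Mstar R₁ R₂ hGR hY T₀ hT₀ a311 M311 ha311 hM311 hΔA
  have hco := coerciveUnder_of_subMajorants_R R₁ R₂ hGR (trBasis N) (trBasis N) (fun x : MemberY θ.d₆ θ.ℓ₆ θ.hd' θ.hL' θ.b₀ θ.b₁ Mstar => GDY x.toKIdx (parSymY x.toKIdx) (parBY x.toKIdx) (GpPhysY x.toKIdx (parSymY x.toKIdx))) T₀ (fun x => parBY x.toKIdx) hparG hlev hβ1 hnbr (R := fun _ => (1 : ℝ)) hcoA hsubT
  obtain ⟨M₄, δ₁, a₄, C4, hM₄, hδ₁, ha₄, hC4, hall⟩ := stmt3132Printed_nu_of_coercive_decay_R (specialUnitaryUnits (Fin N)) R₁ R₂ (trBasis N) (θ.d₆ + 1)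
    (fun (x : MemberY θ.d₆ θ.ℓ₆ θ.hd' θ.hL' θ.b₀ θ.b₁ Mstar) U => QGQOfY x.toKIdx (parBY x.toKIdx) ((fun x : MemberY θ.d₆ θ.ℓ₆ θ.hd' θ.hL' θ.b₀ θ.b₁ Mstar => GDY x.toKIdx (parSymY x.toKIdx) (parBY x.toKIdx) (GpPhysY x.toKIdx (parSymY x.toKIdx))) x) U) (fun (x : MemberY θ.d₆ θ.ℓ₆ θ.hd' θ.hL' θ.b₀ θ.b₁ Mstar) U => QGQOfY x.toKIdx (parBY x.toKIdx) ((fun x : MemberY θ.d₆ θ.ℓ₆ θ.hd' θ.hL' θ.b₀ θ.b₁ Mstar => GDY x.toKIdx (parSymY x.toKIdx) (parBY x.toKIdx) (GpPhysY x.toKIdx (parSymY x.toKIdx))) x) U) hco hdec hco hdec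
  -- the (3.132) kernel bound ⟹ the class letter of `C` in the certificate's currency (n06-w5 `c2_pinsB`, thresholds as in `c_letters_of_row26B`)
  have hK1 : (1 : ℝ) ≤ 2 * ((θ.ℓ₆ : ℝ) + 1) ^ 2 - 1 := by nlinarith [(Nat.cast_nonneg θ.ℓ₆ : (0 : ℝ) ≤ θ.ℓ₆)]
  set Kg : ℝ := (δ₁ - δ₁ / 2) * (2 * ((θ.ℓ₆ : ℝ) + 1) ^ 2 - 1) with hKg
  have hKg0 : 0 < Kg := mul_pos (by linarith) (by linarith)
  set Mg : ℝ := 2 * Real.log (((θ.ℓ₆ + 1 : ℕ) : ℝ)) / Kg with hMg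
  set Bz : ℝ := cR39 (trBasis N) * (coordBound39 (trBasis N) * basisBound39 (trBasis N)) * C4 * (((θ.ℓ₆ + 1 : ℕ) : ℝ)) ^ 2 with hBzdef
  have hBz : 0 ≤ Bz := by
    have h1 : 0 ≤ coordBound39 (trBasis N) := norm_nonneg _
    have h2 : 0 ≤ basisBound39 (trBasis N) := Finset.sum_nonneg fun _ _ => norm_nonneg _
    have h3 := cR39_nonneg (trBasis N)
    positivity
  have hδC : 0 < δ₁ / 2 := by positivity
  have hc2 : ∀ x : MemberY θ.d₆ θ.ℓ₆ θ.hd' θ.hL' θ.b₀ θ.b₁ Mstar, max M₄ Mg ≤ (geo9Y x).M → ∀ α₀ : ℝ, 0 < α₀ → (geo9Y x).M * α₀ ≤ a₄ → ∀ U : (bg9YR (Matrix (Fin N) (Fin N) ℂ) (specialUnitaryUnits (Fin N)) R₁ R₂ x).Cfg, (bg9YR (Matrix (Fin N) (Fin N) ℂ) (specialUnitaryUnits (Fin N)) R₁ R₂ x).Reg335 c α₀ U →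
      (bg9YR (Matrix (Fin N) (Fin N) ℂ) (specialUnitaryUnits (Fin N)) R₁ R₂ x).Reg336 c α₀ U →
      HasMaj (cNorm 1 (H x) (𝔬12 x).blkZ (fun y => (geo9Y_len_pos x y).le) 2)
        (weightNorm (BlockNorm.ofBlocks (toB6 (geo9Y x) 1 (H x)) (𝔬12 x).blkZ) (fun y => ((((θ.ℓ₆ + 1 : ℕ) : ℝ) ^ (θ.d₆ + 1)) ^ lvl x.hN x.D x.hk y)⁻¹) (fun y => (plateau_pos x.toKIdx y).le))
        ((𝔬12 x).C U) (fun a b => Bz * Real.exp (-(δ₁ / 2 * (geo9Y x).dist a b))) := by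
    intro x hM α₀ hα ha U hU hU'
    have hM4 : M₄ ≤ (geo9Y x).M := (le_max_left _ _).trans hM
    have hgap' : 2 * Real.log (((θ.ℓ₆ + 1 : ℕ) : ℝ)) ≤ (δ₁ - δ₁ / 2) * (2 * ((θ.ℓ₆ : ℝ) + 1) ^ 2 - 1) * (geo9Y x).M := by
      have h0 : Mg ≤ (geo9Y x).M := (le_max_right _ _).trans hM
      rw [hMg, div_le_iff₀ hKg0] at h0
      simpa [hKg, mul_comm, mul_left_comm, mul_assoc] using h0
    exact c2_pinsB x (B := bg9YR (Matrix (Fin N) (Fin N) ℂ) (specialUnitaryUnits (Fin N)) R₁ R₂ x) (cfg := fun U => U) (𝔬 := 𝔬12 x) (H := H x) hC4.le (half_lt_self hδ₁) hgap' (le_of_eq hBzdef.symm) (hblkZ12 x) (hCco12 x U)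
      (fun y => (plateau_pos x.toKIdx y).le) (hall x hM4 α₀ hα ha U hU hU').1
  -- the (3.137) letter (`d2sup_of_pins`), regime (MD, aD)
  obtain ⟨MD, aD, θ₂, haD0, haDG, hθ₂0, hD2f⟩ := d2sup_of_pins (N := N) H 𝔠 hGR c hRP2 𝔬12 bI hbI0 hβ1 hblk12 hblkZ12 hGco12 hCco12 (MG := max (max M₀ MG) (max M₄ Mg))
    (lt_min haG0 ha₄) hrG hρG hBz hδC hδ₂ hκC hgap
    (fun x hM α₀ hα ha U hU hU' => (hGD x ((le_max_right _ _).trans ((le_max_left _ _).trans hM)) α₀ hα (ha.trans (min_le_left _ _)) U hU hU').1)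
    (fun x hM α₀ hα ha U hU hU' => hc2 x ((le_max_right _ _).trans hM) α₀ hα (ha.trans (min_le_right _ _)) U hU hU')
    (fun x hM α₀ hα ha U hU hU' => hC2 x ((le_max_left _ _).trans ((le_max_left _ _).trans hM)) α₀ hα ((ha.trans (min_le_left _ _)).trans haGa) U hU hU')
  refine ⟨MD, aD, θ₂, haD0, (haDG.trans (min_le_left _ _)).trans haGa, hθ₂0, fun x hM α₀ hα ha U hU hU' => ?_⟩
  rw [hΔ2def x]
  exact hD2f x hM α₀ hα ha U hU hU'

end Summit.QuantumFields.YangMills.BalabanUVNodes.N06D2SupPrechainV2AtPinsPUW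

end
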